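import Literature.Probability.Moments.PermutedSumBernstein

/-!
# Bernstein's inequality for randomly permuted sums — proof (discharge of the named fact)

`theorem BercuDelyonRio2015_permutedSum_holds : BercuDelyonRio2015_permutedSum` for the named fact
vendored in `Literature/Probability/Moments/PermutedSumBernstein.lean` (Bercu–Delyon–Rio 2015, as
quoted verbatim in Albert 2019, Thm. 1.5). This file only adds the proof machinery (auxiliary
definitions `Z`, `mean`, `rowMass`, …, all in the sub-namespace `BercuDelyonRio`) and theorems; no new
facts.

## Proof

Bercu, Delyon and Rio prove the inequality "based on martingale theory" (Albert 2019, p. 4); their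
book (SpringerBriefs 2015, §4.2) is not held by the literature store, so the argument below is a
self-contained reconstruction of that martingale proof, read off from the printed constants:
`θ = (5/2) ln 3 - 2/3 = (3/2) ln 3 + (ln 3 - 2/3)` is (Chebyshev's sum inequality for the heaviest
rows, processed in decreasing order of their masses `sᵢ = Σⱼ aᵢⱼ²`) + (the column-average part of the
martingale increments, `∫₀^{2/3} (2/3 - x)/(1 - x)² dx = ln 3 - 2/3`); the factor `4 = 2 × 2` is
(two blocks of rows) × (two sides) and `16 = 4 × 4` comes from `P(|A + B| ≥ t) ≤ P(|A| ≥ αt) +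
P(|B| ≥ (1-α)t)` together with Bernstein's bound `exp(-s²/(2(V + b s/3)))` for each block.

Everything is done in counting form over `Equiv.Perm (Fin n)` (finite sums, no measure theory):

* `BercuDelyonRio.core` — the martingale step as an induction on the size, through
  `Equiv.Perm.decomposeFin`: conditioning on the column `p = π 0` of the first row leaves a uniformly
  distributed permutation of the minor (`BercuDelyonRio.minor`); the increment
  `g(p) = a₀ₚ - E Z + E Z(minor)` (`BercuDelyonRio.incr`) is centred (`sum_incr`), bounded
  (`abs_incr_le`) and has second moment at most `2 s₀ + 2 (K-1)/N² Σ_{0<l<K} s_l`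
  (`sum_incr_sq_le`, Cauchy–Schwarz); the one-step exponential bound is Bernstein's
  `exp x ≤ 1 + x + x²/(2(1 - c/3))` for `x ≤ c < 3` (`exp_le_bernstein`, `step_mgf`); the a.s. bound
  on the predictable quadratic variation is the deterministic budget `BercuDelyonRio.W`, which is
  monotone under passing to minors (`W_shift`). Result: `Σ_π exp(λ(Z - EZ)) ≤ N! exp(λ² W/(2(1-λb/3)))`.
* `card_tail_le_of_mgf` — Chernoff's bound in counting form with the Bernstein choice
  `λ = s/(V + bs/3)`.
* `W_block_le` — the budget of a block of `K ≤ (n+1)/2` rows sorted by decreasing mass is at most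
  `(2Q_K/K)·log(n/(n-K)) + Q_K (1/(n-K+1) - 1/n)` (Chebyshev's sum inequality
  `AntivaryOn.card_mul_sum_le_sum_mul_sum`, `Σ 1/r ≤ log`, telescoping).
* `main_bound` — sort the rows by decreasing mass (`Tuple.sort`), split them into the heaviest
  `⌈n/2⌉` and the lightest `⌊n/2⌋` rows (blocks `A`, `B`; `Z - EZ = A + B`, `decomp`), apply the two
  previous steps to `±A` with `(αt, 8α²θv, 8αm)`, `α = 3/5`, and to `±B` with `α = 2/5` (the budgets fit:
  `budgetA`, `budgetB`, using `log 2 < 0.6931471808` and `log 3 > 1`), and add up (`union_four`).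
  The cases `n ≤ 3` are trivial (`4 e^{-E} ≥ 1` there) and `a = 0` gives an empty set.

The block split `⌈n/2⌉ : ⌊n/2⌋` with `α = 3/5` (instead of BDR's `2n/3` rows and `t/2 : t/2`) only
changes the bookkeeping of the same argument and lands inside the printed constants with room to
spare for the crude integer-part estimates used here.

## References

* B. Bercu, B. Delyon, E. Rio, *Concentration Inequalities for Sums and Martingales*, SpringerBriefs
  in Mathematics, Springer (2015), §4.2 (random permutations). [BercuDelyonRio2015] (not held; the
  statement is taken from Albert 2019 and the proof is reconstructed as described above).
* M. Albert, *Concentration inequalities for randomly permuted sums*, in: High Dimensional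
  Probability VIII, Progress in Probability 74, Birkhäuser (2019), Thm. 1.5 (arXiv:1805.03579, p. 4,
  held: `paper:arxiv-1805.03579`, read 2026-08-16). [Albert2019]
-/

noncomputable section

open Finset Equiv

namespace Literature.Probability.Moments

namespace BercuDelyonRio

/-! ### Elementary exponential inequalities -/

section ExpBounds

open Real

/-- `(x - 2) eˣ + x + 2 ≥ 0` for `x ≥ 0`. [folklore] -/
theorem aux_exp_poly_nonneg {x : ℝ} (hx : 0 ≤ x) : 0 ≤ (x - 2) * exp x + x + 2 := by
  have h1 : ∀ y : ℝ, 0 ≤ y → 0 ≤ (y - 1) * exp y + 1 := by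
    intro y hy
    have hpos := exp_pos y
    have h2 : (1 - y) * exp y ≤ 1 := by
      calc (1 - y) * exp y ≤ exp (-y) * exp y := by
            apply mul_le_mul_of_nonneg_right _ hpos.le
            have := add_one_le_exp (-y)
            linarith
        _ = 1 := by rw [← exp_add]; simp
    have h3 : (y - 1) * exp y = -((1 - y) * exp y) := by ring
    rw [h3]; linarith
  set f : ℝ → ℝ := fun y => (y - 2) * exp y + y + 2 with hf
  have hdiff : Differentiable ℝ f := by rw [hf]; fun_prop
  have hderiv : ∀ y, deriv f y = (y - 1) * exp y + 1 := by
    intro y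
    have : HasDerivAt f ((1 * exp y + (y - 2) * exp y) + 1 + 0) y := by
      apply HasDerivAt.add
      apply HasDerivAt.add
      · exact ((hasDerivAt_id y).sub_const 2).mul (hasDerivAt_exp y)
      · exact hasDerivAt_id y
      · exact hasDerivAt_const y 2
    rw [this.deriv]; ring
  have hmono : MonotoneOn f (Set.Ici 0) := by
    refine monotoneOn_of_deriv_nonneg (convex_Ici 0) hdiff.continuous.continuousOn
      hdiff.differentiableOn ?_
    intro y hy
    rw [interior_Ici] at hy
    rw [hderiv]
    exact h1 y (le_of_lt hy)
  have := hmono (Set.mem_Ici.mpr le_rfl) (Set.mem_Ici.mpr hx) hx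
  simpa [hf] using this

/-- For `x ≤ 0`, `exp x ≤ 1 + x + x²/2`. [folklore] -/
theorem exp_le_quad_of_nonpos {x : ℝ} (hx : x ≤ 0) : exp x ≤ 1 + x + x ^ 2 / 2 := by
  set f : ℝ → ℝ := fun y => 1 - y + y ^ 2 / 2 - exp (-y) with hf
  have hdiff : Differentiable ℝ f := by rw [hf]; fun_prop
  have hderiv : ∀ y, deriv f y = -1 + y + exp (-y) := by
    intro y
    have : HasDerivAt f (0 - 1 + (2:ℕ) * y ^ (2 - 1) / 2 - exp (-y) * (-1)) y := by
      apply HasDerivAt.sub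
      apply HasDerivAt.add
      apply HasDerivAt.sub
      · exact hasDerivAt_const y 1
      · exact hasDerivAt_id y
      · exact (hasDerivAt_pow 2 y).div_const 2
      · exact (hasDerivAt_exp (-y)).comp y (hasDerivAt_neg y)
    rw [this.deriv]; simp
  have hmono : MonotoneOn f (Set.Ici 0) := by
    refine monotoneOn_of_deriv_nonneg (convex_Ici 0) hdiff.continuous.continuousOn
      hdiff.differentiableOn ?_
    intro y _
    rw [hderiv]
    have := add_one_le_exp (-y)
    linarith
  have hy : (0:ℝ) ≤ -x := by linarith
  have := hmono (Set.mem_Ici.mpr le_rfl) (Set.mem_Ici.mpr hy) hy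
  simp [hf] at this
  linarith

/-- For `0 ≤ x`, `exp x * (1 - x/3) ≤ 1 + 2x/3 + x²/6`. [folklore] -/
theorem exp_mul_le_of_nonneg {x : ℝ} (hx : 0 ≤ x) :
    exp x * (1 - x / 3) ≤ 1 + 2 * x / 3 + x ^ 2 / 6 := by
  set f : ℝ → ℝ := fun y => 1 + 2 * y / 3 + y ^ 2 / 6 - exp y + y * exp y / 3 with hf
  have hdiff : Differentiable ℝ f := by rw [hf]; fun_prop
  have hderiv : ∀ y, deriv f y = ((y - 2) * exp y + y + 2) / 3 := by
    intro y
    have : HasDerivAt f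
        (0 + 2 * 1 / 3 + (2:ℕ) * y ^ (2 - 1) / 6 - exp y + (1 * exp y + y * exp y) / 3) y := by
      apply HasDerivAt.add
      apply HasDerivAt.sub
      apply HasDerivAt.add
      apply HasDerivAt.add
      · exact hasDerivAt_const y 1
      · exact ((hasDerivAt_id y).const_mul 2).div_const 3
      · exact (hasDerivAt_pow 2 y).div_const 6
      · exact hasDerivAt_exp y
      · exact ((hasDerivAt_id y).mul (hasDerivAt_exp y)).div_const 3
    rw [this.deriv]; simp; ring
  have hmono : MonotoneOn f (Set.Ici 0) := by
    refine monotoneOn_of_deriv_nonneg (convex_Ici 0) hdiff.continuous.continuousOn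
      hdiff.differentiableOn ?_
    intro y hy
    rw [interior_Ici] at hy
    rw [hderiv]
    have := aux_exp_poly_nonneg (le_of_lt hy)
    linarith
  have w0 := hmono (Set.mem_Ici.mpr le_rfl) (Set.mem_Ici.mpr hx) hx
  simp [hf] at w0
  nlinarith [w0]

/-- Bernstein-type exponential bound: for `x ≤ c`, `0 ≤ c < 3`,
`exp x ≤ 1 + x + x² / (2 (1 - c/3))`. [folklore] -/
theorem exp_le_bernstein {x c : ℝ} (hxc : x ≤ c) (hc0 : 0 ≤ c) (hc3 : c < 3) :
    exp x ≤ 1 + x + x ^ 2 / (2 * (1 - c / 3)) := by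
  have hden : 0 < 1 - c / 3 := by linarith
  rcases le_or_gt x 0 with hx | hx
  · have h2 := exp_le_quad_of_nonpos hx
    have h3 : x ^ 2 / 2 ≤ x ^ 2 / (2 * (1 - c / 3)) := by
      apply div_le_div_of_nonneg_left (sq_nonneg x) (by positivity)
      nlinarith
    linarith
  · have hx3 : 0 < 1 - x / 3 := by linarith
    have w0 := exp_mul_le_of_nonneg hx.le
    have step1 : exp x ≤ 1 + x + x ^ 2 / (2 * (1 - x / 3)) := by
      have hpos : (0:ℝ) < 2 * (1 - x / 3) := by positivity
      have key : exp x - 1 - x ≤ x ^ 2 / (2 * (1 - x / 3)) := by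
        rw [le_div_iff₀ hpos]
        nlinarith [w0]
      linarith
    have step2 : x ^ 2 / (2 * (1 - x / 3)) ≤ x ^ 2 / (2 * (1 - c / 3)) := by
      apply div_le_div_of_nonneg_left (sq_nonneg x) (by positivity)
      nlinarith
    linarith


end ExpBounds

/-! ### One martingale step -/

/-- One-step MGF bound (Bernstein form) for a centred finite family bounded above by `b`. [folklore] -/
theorem step_mgf {ι : Type*} [Fintype ι] (g : ι → ℝ) {lam b B : ℝ} (hl : 0 ≤ lam) (hb : 0 ≤ b)
    (hlb : lam * b < 3) (hsum : ∑ j, g j = 0) (hg : ∀ j, g j ≤ b)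
    (hB : ∑ j, g j ^ 2 ≤ Fintype.card ι * B) :
    ∑ j, Real.exp (lam * g j) ≤
      Fintype.card ι * Real.exp (lam ^ 2 / (2 * (1 - lam * b / 3)) * B) := by
  set c := lam * b with hc
  have hc0 : 0 ≤ c := mul_nonneg hl hb
  have hden : 0 < 1 - c / 3 := by linarith
  set Φ := lam ^ 2 / (2 * (1 - lam * b / 3)) with hΦ
  have hΦ0 : 0 ≤ Φ := by rw [hΦ]; positivity
  have h1 : ∀ j, Real.exp (lam * g j) ≤ 1 + lam * g j + Φ * g j ^ 2 := by
    intro j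
    have hx : lam * g j ≤ c := by rw [hc]; exact mul_le_mul_of_nonneg_left (hg j) hl
    have := exp_le_bernstein hx hc0 hlb
    calc Real.exp (lam * g j) ≤ 1 + lam * g j + (lam * g j) ^ 2 / (2 * (1 - c / 3)) := this
      _ = 1 + lam * g j + Φ * g j ^ 2 := by rw [hΦ, hc]; ring
  have h2 : ∑ j, Real.exp (lam * g j) ≤ ∑ j, (1 + lam * g j + Φ * g j ^ 2) :=
    Finset.sum_le_sum fun j _ => h1 j
  have h3 : ∑ j, (1 + lam * g j + Φ * g j ^ 2)
      = Fintype.card ι + lam * ∑ j, g j + Φ * ∑ j, g j ^ 2 := by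
    rw [Finset.sum_add_distrib, Finset.sum_add_distrib, Finset.mul_sum, Finset.mul_sum]
    simp
  rw [h3, hsum, mul_zero, add_zero] at h2
  have h4 : (Fintype.card ι : ℝ) + Φ * ∑ j, g j ^ 2 ≤ Fintype.card ι * (1 + Φ * B) := by
    have := mul_le_mul_of_nonneg_left hB hΦ0
    nlinarith
  have h5 : (1 : ℝ) + Φ * B ≤ Real.exp (Φ * B) := by
    have := Real.add_one_le_exp (Φ * B); linarith
  calc ∑ j, Real.exp (lam * g j) ≤ Fintype.card ι + Φ * ∑ j, g j ^ 2 := h2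
    _ ≤ Fintype.card ι * (1 + Φ * B) := h4
    _ ≤ Fintype.card ι * Real.exp (Φ * B) := by
        apply mul_le_mul_of_nonneg_left h5 (Nat.cast_nonneg _)


/-! ### Permuted sums, minors, increments -/

variable {N : ℕ}

/-- The permuted sum `Z_c(σ) = Σ_i c i (σ i)`. [folklore] -/
def Z (c : Fin N → Fin N → ℝ) (σ : Perm (Fin N)) : ℝ := ∑ i, c i (σ i)

/-- Its mean over the uniform law on `S_N`: `(Σ_{i,j} c i j) / N`. [folklore] -/
def mean (c : Fin N → Fin N → ℝ) : ℝ := (∑ i, ∑ j, c i j) / N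

/-- Row sum of squares. [folklore] -/
def rowMass (c : Fin N → Fin N → ℝ) (i : Fin N) : ℝ := ∑ j, c i j ^ 2

/-- Row mean. [folklore] -/
def rowMean (c : Fin N → Fin N → ℝ) (i : Fin N) : ℝ := (∑ j, c i j) / N

/-- The minor obtained by deleting row `0` and column `p`, columns re-indexed through
`x ↦ swap 0 p x.succ` (the indexing used by `Equiv.Perm.decomposeFin`). [folklore] -/
def minor (c : Fin (N + 1) → Fin (N + 1) → ℝ) (p : Fin (N + 1)) : Fin N → Fin N → ℝ :=
  fun i x => c i.succ (Equiv.swap 0 p x.succ)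

/-- The martingale increment as a function of the first exposed column `p`. [folklore] -/
def incr (c : Fin (N + 1) → Fin (N + 1) → ℝ) (p : Fin (N + 1)) : ℝ :=
  c 0 p - mean c + mean (minor c p)

/-- Summing over the columns `swap 0 p x.succ`, `x : Fin N`, is summing over all columns but `p`.
[folklore] -/
theorem sum_swap_succ (p : Fin (N + 1)) (f : Fin (N + 1) → ℝ) :
    ∑ x : Fin N, f (Equiv.swap 0 p x.succ) = (∑ j, f j) - f p := by
  have h := Equiv.sum_comp (Equiv.swap (0 : Fin (N+1)) p) f
  rw [Fin.sum_univ_succ, Equiv.swap_apply_left] at h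
  linarith

/-- The permuted sum splits along `Equiv.Perm.decomposeFin`: first row plus the permuted sum of the
minor. [folklore] -/
theorem Z_decompose (c : Fin (N + 1) → Fin (N + 1) → ℝ) (p : Fin (N + 1)) (e : Perm (Fin N)) :
    Z c (Perm.decomposeFin.symm (p, e)) = c 0 p + Z (minor c p) e := by
  unfold Z minor
  rw [Fin.sum_univ_succ, Perm.decomposeFin_symm_apply_zero]
  simp only [Perm.decomposeFin_symm_apply_succ]

/-- Sum over `S_{N+1}` as an iterated sum over the image of `0` and `S_N`
(`Finset.univ_perm_fin_succ`). [folklore] -/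
theorem sum_perm_succ (F : Perm (Fin (N + 1)) → ℝ) :
    ∑ σ, F σ = ∑ p : Fin (N + 1), ∑ e : Perm (Fin N), F (Perm.decomposeFin.symm (p, e)) := by
  rw [Finset.univ_perm_fin_succ, ← Finset.univ_product_univ]
  simp only [Finset.sum_map, Equiv.toEmbedding_apply, Finset.sum_product]

/-- Rows of a minor are lighter than the corresponding rows. [folklore] -/
theorem rowMass_minor_le (c : Fin (N + 1) → Fin (N + 1) → ℝ) (p : Fin (N + 1)) (i : Fin N) :
    rowMass (minor c p) i ≤ rowMass c i.succ := by
  unfold rowMass minor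
  rw [sum_swap_succ p (fun j => c i.succ j ^ 2)]
  nlinarith [sq_nonneg (c i.succ p)]

/-- The mean of the minor in terms of the row sums of the array. [folklore] -/
theorem mean_minor (c : Fin (N + 1) → Fin (N + 1) → ℝ) (p : Fin (N + 1)) :
    mean (minor c p) = (∑ i : Fin N, ((∑ j, c i.succ j) - c i.succ p)) / N := by
  unfold mean minor
  congr 1
  refine Finset.sum_congr rfl fun i _ => ?_
  exact sum_swap_succ p (fun j => c i.succ j)

/-- The increment is (centred first-row entry) minus (average of the centred entries of column `p`
below it) — the martingale increment of the exposure martingale. [folklore] -/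
theorem incr_eq (c : Fin (N + 1) → Fin (N + 1) → ℝ) (p : Fin (N + 1)) :
    incr c p = (c 0 p - rowMean c 0) - (∑ i : Fin N, (c i.succ p - rowMean c i.succ)) / N := by
  unfold incr
  rw [mean_minor]
  unfold mean rowMean
  have hN1 : ((N + 1 : ℕ) : ℝ) = N + 1 := by push_cast; ring
  rw [Fin.sum_univ_succ, hN1]
  rw [Finset.sum_sub_distrib, Finset.sum_sub_distrib, ← Finset.sum_div]
  set A := ∑ i : Fin N, ∑ j, c i.succ j
  set T := ∑ i : Fin N, c i.succ p
  set S0 := ∑ j, c 0 j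
  rcases Nat.eq_zero_or_pos N with hN | hN
  · subst hN
    have hp : p = 0 := Fin.ext (by have := p.2; simp only [Fin.val_zero]; omega)
    subst hp
    simp [A, T, S0]
  · have hN' : (N : ℝ) ≠ 0 := by exact_mod_cast hN.ne'
    field_simp
    ring

/-- Centred rows sum to zero. [folklore] -/
theorem sum_rowMean_sub (c : Fin (N + 1) → Fin (N + 1) → ℝ) (i : Fin (N + 1)) :
    ∑ p, (c i p - rowMean c i) = 0 := by
  unfold rowMean
  rw [Finset.sum_sub_distrib]
  simp only [Finset.sum_const, Finset.card_univ, Fintype.card_fin, nsmul_eq_mul]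
  have hN1 : ((N + 1 : ℕ) : ℝ) ≠ 0 := by positivity
  field_simp
  ring

/-- The increments are centred (martingale property). [folklore] -/
theorem sum_incr (c : Fin (N + 1) → Fin (N + 1) → ℝ) : ∑ p, incr c p = 0 := by
  simp_rw [incr_eq]
  rw [Finset.sum_sub_distrib, ← Finset.sum_div, Finset.sum_comm, sum_rowMean_sub]
  simp only [sum_rowMean_sub, Finset.sum_const_zero, zero_div, sub_zero]


/-! ### Variance and size of the increment -/

/-- Centred sum of squares is at most the raw sum of squares. [folklore] -/
theorem sum_sq_sub_mean_le (f : Fin (N + 1) → ℝ) :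
    ∑ p, (f p - (∑ j, f j) / ((N + 1 : ℕ) : ℝ)) ^ 2 ≤ ∑ p, f p ^ 2 := by
  set μ := (∑ j, f j) / ((N + 1 : ℕ) : ℝ) with hμ
  have hN1 : (0 : ℝ) < ((N + 1 : ℕ) : ℝ) := by positivity
  have hsum : ∑ j, f j = ((N + 1 : ℕ) : ℝ) * μ := by
    rw [hμ]; field_simp
  have : ∑ p, (f p - μ) ^ 2 = ∑ p, f p ^ 2 - ((N + 1 : ℕ) : ℝ) * μ ^ 2 := by
    simp only [sub_sq, Finset.sum_add_distrib, Finset.sum_sub_distrib, Finset.sum_const,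
      Finset.card_univ, Fintype.card_fin, nsmul_eq_mul]
    rw [show ∑ x, 2 * f x * μ = 2 * μ * ∑ x, f x by
      rw [Finset.mul_sum]; exact Finset.sum_congr rfl (fun x _ => by ring)]
    rw [hsum]; ring
  rw [this]
  nlinarith [sq_nonneg μ]

/-- Row means of an array bounded by `m` are bounded by `m`. [folklore] -/
theorem abs_rowMean_le (c : Fin (N + 1) → Fin (N + 1) → ℝ) {m : ℝ} (hm : ∀ i j, |c i j| ≤ m)
    (i : Fin (N + 1)) : |rowMean c i| ≤ m := by
  unfold rowMean
  have hN1 : (0 : ℝ) < ((N + 1 : ℕ) : ℝ) := by positivity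
  rw [abs_div, abs_of_pos hN1, div_le_iff₀ hN1]
  calc |∑ j, c i j| ≤ ∑ j, |c i j| := Finset.abs_sum_le_sum_abs _ _
    _ ≤ ∑ _j : Fin (N + 1), m := Finset.sum_le_sum fun j _ => hm i j
    _ = m * ((N + 1 : ℕ) : ℝ) := by simp [mul_comm]

/-- The set of row indices `i : Fin N` with `i + 1 < K` has at most `K - 1` elements. [folklore] -/
theorem card_filter_succ_lt (K : ℕ) :
    ((univ.filter fun i : Fin N => (i : ℕ) + 1 < K).card : ℝ) ≤ (K : ℝ) - 1 ∨ K = 0 := by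
  rcases Nat.eq_zero_or_pos K with hK | hK
  · exact Or.inr hK
  · left
    have h : (univ.filter fun i : Fin N => (i : ℕ) + 1 < K).card ≤ K - 1 := by
      have : (univ.filter fun i : Fin N => (i : ℕ) + 1 < K).map Fin.valEmbedding ⊆ range (K - 1) := by
        intro x hx
        simp only [Finset.mem_map, Finset.mem_filter, Finset.mem_univ, true_and,
          Fin.valEmbedding_apply] at hx
        obtain ⟨i, hi, rfl⟩ := hx
        simp only [Finset.mem_range]; omega
      have := Finset.card_le_card this
      simpa using this
    have : (((univ.filter fun i : Fin N => (i : ℕ) + 1 < K).card : ℕ) : ℝ) ≤ ((K - 1 : ℕ) : ℝ) := by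
      exact_mod_cast h
    rw [Nat.cast_sub hK] at this
    simpa using this

/-- Variance bound for the increment. [folklore] -/
theorem sum_incr_sq_le (c : Fin (N + 1) → Fin (N + 1) → ℝ) (K : ℕ) (hK : 1 ≤ K)
    (hzero : ∀ i : Fin (N + 1), K ≤ (i : ℕ) → ∀ j, c i j = 0) :
    ∑ p, incr c p ^ 2 ≤ 2 * rowMass c 0 +
      2 * (((K : ℝ) - 1) / (N : ℝ) ^ 2) *
        ∑ i ∈ univ.filter (fun i : Fin N => (i : ℕ) + 1 < K), rowMass c i.succ := by
  set S := univ.filter (fun i : Fin N => (i : ℕ) + 1 < K) with hS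
  set u : Fin (N + 1) → ℝ := fun p => c 0 p - rowMean c 0 with hu
  set w : Fin N → Fin (N + 1) → ℝ := fun i p => c i.succ p - rowMean c i.succ with hw
  set v : Fin (N + 1) → ℝ := fun p => (∑ i ∈ S, w i p) / N with hv
  -- rows outside S vanish
  have hwS : ∀ p, ∑ i, w i p = ∑ i ∈ S, w i p := by
    intro p
    symm
    apply Finset.sum_subset (Finset.filter_subset _ _)
    intro i _ hi
    simp only [Finset.mem_filter, Finset.mem_univ, true_and, not_lt] at hi
    have h1 : ∀ j, c i.succ j = 0 := hzero i.succ (by simp; omega)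
    simp [hw, rowMean, h1]
  have hincr : ∀ p, incr c p = u p - v p := by
    intro p
    rw [incr_eq, hwS]
  -- step 1: pointwise
  have h1 : ∀ p, incr c p ^ 2 ≤ 2 * u p ^ 2 + 2 * v p ^ 2 := by
    intro p; rw [hincr]; nlinarith [sq_nonneg (u p + v p)]
  -- step 2: Σ u² ≤ rowMass c 0
  have h2 : ∑ p, u p ^ 2 ≤ rowMass c 0 := by
    simp only [hu, rowMean, rowMass]
    exact sum_sq_sub_mean_le (c 0)
  -- step 3: v² ≤ (K-1)/N² Σ_S w²
  have hcard : (S.card : ℝ) ≤ (K : ℝ) - 1 := by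
    rcases card_filter_succ_lt (N := N) K with h | h
    · exact h
    · omega
  have h3 : ∀ p, v p ^ 2 ≤ (((K : ℝ) - 1) / (N : ℝ) ^ 2) * ∑ i ∈ S, w i p ^ 2 := by
    intro p
    simp only [hv]
    rw [div_pow, div_mul_eq_mul_div, ]
    apply div_le_div_of_nonneg_right _ (sq_nonneg _)
    calc (∑ i ∈ S, w i p) ^ 2 ≤ S.card * ∑ i ∈ S, w i p ^ 2 := sq_sum_le_card_mul_sum_sq
      _ ≤ ((K : ℝ) - 1) * ∑ i ∈ S, w i p ^ 2 := by
          apply mul_le_mul_of_nonneg_right hcard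
          exact Finset.sum_nonneg fun i _ => sq_nonneg _
  -- step 4: Σ_p Σ_S w² ≤ Σ_S rowMass
  have h4 : ∑ p, ∑ i ∈ S, w i p ^ 2 ≤ ∑ i ∈ S, rowMass c i.succ := by
    rw [Finset.sum_comm]
    apply Finset.sum_le_sum
    intro i _
    simp only [hw, rowMean, rowMass]
    exact sum_sq_sub_mean_le (c i.succ)
  have hKpos : (0 : ℝ) ≤ ((K : ℝ) - 1) / (N : ℝ) ^ 2 := by
    apply div_nonneg _ (sq_nonneg _)
    have : (1 : ℝ) ≤ K := by exact_mod_cast hK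
    linarith
  calc ∑ p, incr c p ^ 2 ≤ ∑ p, (2 * u p ^ 2 + 2 * v p ^ 2) := Finset.sum_le_sum fun p _ => h1 p
    _ = 2 * ∑ p, u p ^ 2 + 2 * ∑ p, v p ^ 2 := by
        rw [Finset.sum_add_distrib, Finset.mul_sum, Finset.mul_sum]
    _ ≤ 2 * rowMass c 0 + 2 * ∑ p, (((K : ℝ) - 1) / (N : ℝ) ^ 2) * ∑ i ∈ S, w i p ^ 2 := by
        apply add_le_add
        · exact mul_le_mul_of_nonneg_left h2 (by norm_num)
        · exact mul_le_mul_of_nonneg_left (Finset.sum_le_sum fun p _ => h3 p) (by norm_num)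
    _ = 2 * rowMass c 0 + 2 * (((K : ℝ) - 1) / (N : ℝ) ^ 2) * ∑ p, ∑ i ∈ S, w i p ^ 2 := by
        rw [← Finset.mul_sum]; ring
    _ ≤ 2 * rowMass c 0 + 2 * (((K : ℝ) - 1) / (N : ℝ) ^ 2) * ∑ i ∈ S, rowMass c i.succ := by
        have := mul_le_mul_of_nonneg_left h4 hKpos
        linarith

/-- Bound on the increment. [folklore] -/
theorem abs_incr_le (c : Fin (N + 1) → Fin (N + 1) → ℝ) (K : ℕ) (hK : 1 ≤ K) {m : ℝ}
    (hm : ∀ i j, |c i j| ≤ m)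
    (hzero : ∀ i : Fin (N + 1), K ≤ (i : ℕ) → ∀ j, c i j = 0) (p : Fin (N + 1)) :
    |incr c p| ≤ 2 * m + 2 * m * ((K : ℝ) - 1) / N := by
  have hm0 : 0 ≤ m := le_trans (abs_nonneg _) (hm 0 0)
  set S := univ.filter (fun i : Fin N => (i : ℕ) + 1 < K) with hS
  set w : Fin N → Fin (N + 1) → ℝ := fun i p => c i.succ p - rowMean c i.succ with hw
  have hwS : ∑ i, w i p = ∑ i ∈ S, w i p := by
    symm
    apply Finset.sum_subset (Finset.filter_subset _ _)
    intro i _ hi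
    simp only [Finset.mem_filter, Finset.mem_univ, true_and, not_lt] at hi
    have h1 : ∀ j, c i.succ j = 0 := hzero i.succ (by simp; omega)
    simp [hw, rowMean, h1]
  have hu : |c 0 p - rowMean c 0| ≤ 2 * m := by
    calc |c 0 p - rowMean c 0| ≤ |c 0 p| + |rowMean c 0| := abs_sub _ _
      _ ≤ m + m := add_le_add (hm 0 p) (abs_rowMean_le c hm 0)
      _ = 2 * m := by ring
  have hwb : ∀ i, |w i p| ≤ 2 * m := by
    intro i
    calc |w i p| ≤ |c i.succ p| + |rowMean c i.succ| := abs_sub _ _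
      _ ≤ m + m := add_le_add (hm _ _) (abs_rowMean_le c hm _)
      _ = 2 * m := by ring
  have hcard : (S.card : ℝ) ≤ (K : ℝ) - 1 := by
    rcases card_filter_succ_lt (N := N) K with h | h
    · exact h
    · omega
  have hv : |(∑ i : Fin N, w i p) / N| ≤ 2 * m * ((K : ℝ) - 1) / N := by
    rw [hwS, abs_div, Nat.abs_cast]
    apply div_le_div_of_nonneg_right _ (Nat.cast_nonneg _)
    calc |∑ i ∈ S, w i p| ≤ ∑ i ∈ S, |w i p| := Finset.abs_sum_le_sum_abs _ _
      _ ≤ ∑ _i ∈ S, 2 * m := Finset.sum_le_sum fun i _ => hwb i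
      _ = S.card * (2 * m) := by simp
      _ ≤ ((K : ℝ) - 1) * (2 * m) := mul_le_mul_of_nonneg_right hcard (by linarith)
      _ = 2 * m * ((K : ℝ) - 1) := by ring
  rw [incr_eq]
  calc |c 0 p - rowMean c 0 - (∑ i : Fin N, (c i.succ p - rowMean c i.succ)) / N|
      ≤ |c 0 p - rowMean c 0| + |(∑ i : Fin N, (c i.succ p - rowMean c i.succ)) / N| := abs_sub _ _
    _ ≤ 2 * m + 2 * m * ((K : ℝ) - 1) / N := add_le_add hu hv


/-! ### The variance budget -/

/-- The deterministic variance budget. [folklore] -/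
def W (N K : ℕ) (s : Fin N → ℝ) : ℝ :=
  ∑ k : Fin N, if (k : ℕ) < K then
    (2 / ((N : ℝ) - k)) * (s k + (((K : ℝ) - 1 - k) / ((N : ℝ) - 1 - k) ^ 2) *
        ∑ l : Fin N, if (k : ℕ) < l ∧ (l : ℕ) < K then s l else 0)
  else 0

/-- The first term of the budget for size `N + 1`. [folklore] -/
def T0 (N K : ℕ) (s : Fin (N + 1) → ℝ) : ℝ :=
  (2 / ((N : ℝ) + 1)) * (s 0 + (((K : ℝ) - 1) / (N : ℝ) ^ 2) *
    ∑ i ∈ univ.filter (fun i : Fin N => (i : ℕ) + 1 < K), s i.succ)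

/-- The budget is nonnegative for nonnegative masses. [folklore] -/
theorem W_nonneg (N K : ℕ) (s : Fin N → ℝ) (hs : ∀ i, 0 ≤ s i) : 0 ≤ W N K s := by
  unfold W
  apply Finset.sum_nonneg
  intro k _
  split_ifs with hk
  · apply mul_nonneg
    · apply div_nonneg (by norm_num)
      have : (k : ℝ) < N := by exact_mod_cast k.2
      linarith
    · apply add_nonneg (hs k)
      apply mul_nonneg
      · apply div_nonneg _ (sq_nonneg _)
        have : (k : ℝ) + 1 ≤ K := by exact_mod_cast hk
        linarith
      · apply Finset.sum_nonneg
        intro l _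
        split_ifs
        · exact hs l
        · exact le_rfl
  · exact le_rfl

/-- Shift lemma: the budget of a minor plus the first term is at most the budget. [folklore] -/
theorem W_shift (N K : ℕ) (hK : 1 ≤ K) (s : Fin (N + 1) → ℝ) (s' : Fin N → ℝ)
    (hs : ∀ i, 0 ≤ s i) (hss' : ∀ i, s' i ≤ s i.succ) :
    W N (K - 1) s' + T0 N K s ≤ W (N + 1) K s := by
  have hK1 : ((K - 1 : ℕ) : ℝ) = (K : ℝ) - 1 := by rw [Nat.cast_sub hK]; simp
  -- expand W (N+1) K s via Fin.sum_univ_succ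
  unfold W
  rw [Fin.sum_univ_succ]
  -- first term
  have hT0 : T0 N K s = (if ((0 : Fin (N + 1)) : ℕ) < K then
      (2 / (((N + 1 : ℕ) : ℝ) - ((0 : Fin (N + 1)) : ℕ))) * (s 0 +
        (((K : ℝ) - 1 - ((0 : Fin (N + 1)) : ℕ)) / (((N + 1 : ℕ) : ℝ) - 1 - ((0 : Fin (N + 1)) : ℕ)) ^ 2) *
        ∑ l : Fin (N + 1), if ((0 : Fin (N + 1)) : ℕ) < l ∧ (l : ℕ) < K then s l else 0)
      else 0) := by
    have h0 : ((0 : Fin (N + 1)) : ℕ) < K := by simp; omega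
    rw [if_pos h0]
    unfold T0
    simp only [Fin.val_zero, Nat.cast_zero, sub_zero, Nat.cast_add, Nat.cast_one, add_sub_cancel_right]
    congr 2
    rw [Fin.sum_univ_succ]
    simp only [Fin.val_zero, lt_self_iff_false, false_and, if_false, zero_add, Fin.val_succ,
      Nat.zero_lt_succ, true_and]
    rw [Finset.sum_filter]
  rw [hT0, add_comm]
  refine add_le_add le_rfl ?_
  -- remaining terms: compare termwise
  apply Finset.sum_le_sum
  intro k _
  have hkK : ((k : ℕ) < K - 1) ↔ ((k.succ : ℕ) < K) := by simp [Fin.val_succ]; omega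
  by_cases hk : (k : ℕ) < K - 1
  · rw [if_pos hk, if_pos (hkK.mp hk)]
    have hkN : (k : ℝ) < N := by exact_mod_cast k.2
    have e1 : (((N + 1 : ℕ) : ℝ) - ((k.succ : ℕ) : ℝ)) = (N : ℝ) - k := by
      simp [Fin.val_succ]
    have e2 : ((K : ℝ) - 1 - ((k.succ : ℕ) : ℝ)) = ((K - 1 : ℕ) : ℝ) - 1 - k := by
      rw [hK1]; simp [Fin.val_succ]; ring
    have e3 : (((N + 1 : ℕ) : ℝ) - 1 - ((k.succ : ℕ) : ℝ)) = (N : ℝ) - 1 - k := by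
      simp [Fin.val_succ]; ring
    rw [e1, e2, e3]
    have hcoef1 : 0 ≤ 2 / ((N : ℝ) - k) := div_nonneg (by norm_num) (by linarith)
    have hcoef2 : 0 ≤ (((K - 1 : ℕ) : ℝ) - 1 - k) / ((N : ℝ) - 1 - k) ^ 2 := by
      apply div_nonneg _ (sq_nonneg _)
      rw [hK1]
      have : (k : ℝ) + 1 ≤ ((K - 1 : ℕ) : ℝ) := by exact_mod_cast hk
      rw [hK1] at this; linarith
    apply mul_le_mul_of_nonneg_left _ hcoef1
    apply add_le_add (hss' k)
    apply mul_le_mul_of_nonneg_left _ hcoef2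
    -- inner sums
    rw [Fin.sum_univ_succ]
    simp only [Fin.val_zero, not_lt_zero, false_and, if_false, zero_add, Fin.val_succ]
    apply Finset.sum_le_sum
    intro l _
    by_cases hl : (k : ℕ) < l ∧ (l : ℕ) < K - 1
    · rw [if_pos hl, if_pos (by omega)]
      exact hss' l
    · rw [if_neg hl]
      split_ifs
      · exact hs _
      · exact le_rfl
  · rw [if_neg hk, if_neg (by rw [← hkK]; exact hk)]


/-! ### The core exponential-moment bound -/

/-- Row masses are nonnegative. [folklore] -/
theorem rowMass_nonneg (c : Fin N → Fin N → ℝ) (i : Fin N) : 0 ≤ rowMass c i :=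
  Finset.sum_nonneg fun _ _ => sq_nonneg _

/-- The core MGF bound, by induction on the size. [cite: Albert2019, Thm. 1.5] -/
theorem core : ∀ (N : ℕ) (c : Fin N → Fin N → ℝ) (K : ℕ) (m b lam : ℝ),
    (∀ i : Fin N, K ≤ (i : ℕ) → ∀ j, c i j = 0) → (∀ i j, |c i j| ≤ m) → 0 ≤ m →
    2 * m ≤ b → b ≤ 4 * m →
    2 * m * ((N : ℝ) - 1) + 2 * m * ((K : ℝ) - 1) ≤ b * ((N : ℝ) - 1) →
    0 ≤ lam → lam * b < 3 →
    ∑ σ : Perm (Fin N), Real.exp (lam * (Z c σ - mean c)) ≤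
      (N.factorial : ℝ) * Real.exp (lam ^ 2 / (2 * (1 - lam * b / 3)) * W N K (rowMass c)) := by
  intro N
  induction N with
  | zero =>
    intro c K m b lam _ _ _ _ _ _ _ _
    simp [Z, mean, W]
  | succ N ih =>
    intro c K m b lam hzero hm hm0 hmb hb4 hb hl hlb
    set Φ := lam ^ 2 / (2 * (1 - lam * b / 3)) with hΦ
    have hb0 : 0 ≤ b := by linarith
    have hden : 0 < 1 - lam * b / 3 := by linarith
    have hΦ0 : 0 ≤ Φ := by rw [hΦ]; positivity
    have hrm : ∀ i, 0 ≤ rowMass c i := rowMass_nonneg c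
    rcases Nat.eq_zero_or_pos K with hK | hK
    · -- all rows vanish
      subst hK
      have hc : ∀ i j, c i j = 0 := fun i j => hzero i (Nat.zero_le _) j
      have hZ : ∀ σ, Z c σ - mean c = 0 := by
        intro σ; simp [Z, mean, hc]
      simp_rw [hZ, mul_zero, Real.exp_zero]
      simp only [Finset.sum_const, Finset.card_univ, Fintype.card_perm, Fintype.card_fin,
        nsmul_eq_mul, mul_one]
      apply le_mul_of_one_le_right (Nat.cast_nonneg _)
      apply Real.one_le_exp
      exact mul_nonneg hΦ0 (W_nonneg _ _ _ hrm)
    · -- main step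
      have hK1 : ((K - 1 : ℕ) : ℝ) = (K : ℝ) - 1 := by rw [Nat.cast_sub hK]; simp
      have hNc : (((N + 1 : ℕ) : ℝ) - 1) = N := by push_cast; ring
      rw [hNc] at hb
      rw [sum_perm_succ]
      have hdec : ∀ p e, lam * (Z c (Perm.decomposeFin.symm (p, e)) - mean c)
          = lam * incr c p + lam * (Z (minor c p) e - mean (minor c p)) := by
        intro p e; rw [Z_decompose]; unfold incr; ring
      simp_rw [hdec, Real.exp_add, ← Finset.mul_sum]
      -- bound for each minor
      set W' := W (N + 1) K (rowMass c) with hW'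
      set t0 := T0 N K (rowMass c) with ht0
      set M := (N.factorial : ℝ) * Real.exp (Φ * (W' - t0)) with hM
      have hminor : ∀ p, ∑ e : Perm (Fin N),
          Real.exp (lam * (Z (minor c p) e - mean (minor c p))) ≤ M := by
        intro p
        have h1 := ih (minor c p) (K - 1) m b lam
          (fun i hi x => by
            unfold minor
            exact hzero i.succ (by simp [Fin.val_succ]; omega) _)
          (fun i x => hm _ _) hm0 hmb hb4
          (by rw [hK1]; linarith) hl hlb
        have h2 : W N (K - 1) (rowMass (minor c p)) ≤ W' - t0 := by
          have := W_shift N K hK (rowMass c) (rowMass (minor c p)) hrm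
            (fun i => rowMass_minor_le c p i)
          rw [hW', ht0]; linarith
        calc _ ≤ (N.factorial : ℝ) * Real.exp (Φ * W N (K - 1) (rowMass (minor c p))) := h1
          _ ≤ M := by
            rw [hM]
            apply mul_le_mul_of_nonneg_left _ (Nat.cast_nonneg _)
            apply Real.exp_le_exp.mpr
            exact mul_le_mul_of_nonneg_left h2 hΦ0
      -- the increments
      have hg : ∑ p, Real.exp (lam * incr c p) ≤ ((N : ℝ) + 1) * Real.exp (Φ * t0) := by
        have hgb : ∀ p, incr c p ≤ b := by
          intro p
          have h1 := abs_incr_le c K hK hm hzero p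
          have h2 : 2 * m + 2 * m * ((K : ℝ) - 1) / N ≤ b := by
            rcases Nat.eq_zero_or_pos N with hN | hN
            · subst hN; simp; linarith
            · have hN' : (0 : ℝ) < N := by exact_mod_cast hN
              rw [← sub_nonneg]
              have : b - (2 * m + 2 * m * ((K : ℝ) - 1) / N)
                  = (b * N - (2 * m * N + 2 * m * ((K : ℝ) - 1))) / N := by
                field_simp
              rw [this]
              apply div_nonneg _ hN'.le
              linarith
          linarith [le_abs_self (incr c p)]
        have hB : ∑ p, incr c p ^ 2 ≤ Fintype.card (Fin (N + 1)) * t0 := by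
          have := sum_incr_sq_le c K hK hzero
          rw [Fintype.card_fin, ht0]
          unfold T0
          have hN1 : ((N + 1 : ℕ) : ℝ) = (N : ℝ) + 1 := by push_cast; ring
          rw [hN1]
          have hne : (N : ℝ) + 1 ≠ 0 := by positivity
          calc _ ≤ _ := this
            _ = _ := by field_simp
        have := step_mgf (fun p => incr c p) hl hb0 hlb (sum_incr c) hgb hB
        simpa [Fintype.card_fin] using this
      -- assemble
      calc ∑ p, Real.exp (lam * incr c p) *
              ∑ e : Perm (Fin N), Real.exp (lam * (Z (minor c p) e - mean (minor c p)))
          ≤ ∑ p, Real.exp (lam * incr c p) * M := by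
            apply Finset.sum_le_sum
            intro p _
            exact mul_le_mul_of_nonneg_left (hminor p) (Real.exp_pos _).le
        _ = M * ∑ p, Real.exp (lam * incr c p) := by rw [← Finset.sum_mul]; ring
        _ ≤ M * (((N : ℝ) + 1) * Real.exp (Φ * t0)) := by
            apply mul_le_mul_of_nonneg_left hg
            rw [hM]; positivity
        _ = ((N + 1).factorial : ℝ) * Real.exp (Φ * W') := by
            have he : Real.exp (Φ * (W' - t0)) * Real.exp (Φ * t0) = Real.exp (Φ * W') := by
              rw [← Real.exp_add]; ring_nf
            rw [hM, Nat.factorial_succ]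
            push_cast
            rw [← he]
            ring


/-! ### Tails, harmonic sums, numerical constants -/

/-- Chernoff in counting form + Bernstein algebra. [folklore] -/
theorem card_tail_le_of_mgf {α : Type*} [Fintype α] (X : α → ℝ) {C V b : ℝ}
    (hV : 0 < V) (hb : 0 ≤ b)
    (hmgf : ∀ lam : ℝ, 0 ≤ lam → lam * b < 3 →
      ∑ x, Real.exp (lam * X x) ≤ C * Real.exp (lam ^ 2 / (2 * (1 - lam * b / 3)) * V))
    {s : ℝ} (hs : 0 ≤ s) :
    ((univ.filter fun x => s ≤ X x).card : ℝ) ≤ C * Real.exp (-(s ^ 2 / (2 * (V + b * s / 3)))) := by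
  set D := V + b * s / 3 with hD
  have hD0 : 0 < D := by rw [hD]; positivity
  set lam := s / D with hlam
  have hl : 0 ≤ lam := by rw [hlam]; positivity
  have hlb : lam * b < 3 := by
    rw [hlam, div_mul_eq_mul_div, div_lt_iff₀ hD0, hD]
    nlinarith
  have h1 : ((univ.filter fun x => s ≤ X x).card : ℝ) * Real.exp (lam * s)
      ≤ ∑ x, Real.exp (lam * X x) := by
    calc ((univ.filter fun x => s ≤ X x).card : ℝ) * Real.exp (lam * s)
        = ∑ _x ∈ univ.filter (fun x => s ≤ X x), Real.exp (lam * s) := by simp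
      _ ≤ ∑ x ∈ univ.filter (fun x => s ≤ X x), Real.exp (lam * X x) := by
          apply Finset.sum_le_sum
          intro x hx
          simp only [Finset.mem_filter, Finset.mem_univ, true_and] at hx
          exact Real.exp_le_exp.mpr (mul_le_mul_of_nonneg_left hx hl)
      _ ≤ ∑ x, Real.exp (lam * X x) :=
          Finset.sum_le_sum_of_subset_of_nonneg (Finset.filter_subset _ _)
            (fun _ _ _ => (Real.exp_pos _).le)
  have h2 := hmgf lam hl hlb
  have hkey : lam ^ 2 / (2 * (1 - lam * b / 3)) * V - lam * s = -(s ^ 2 / (2 * D)) := by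
    have hV' : V ≠ 0 := hV.ne'
    have hD' : D ≠ 0 := hD0.ne'
    have e1 : 1 - lam * b / 3 = V / D := by
      rw [hlam]; field_simp; rw [hD]; ring
    rw [e1, hlam]
    field_simp
    ring
  have h3 : ((univ.filter fun x => s ≤ X x).card : ℝ)
      ≤ C * Real.exp (lam ^ 2 / (2 * (1 - lam * b / 3)) * V) * Real.exp (-(lam * s)) := by
    have hpos := Real.exp_pos (lam * s)
    rw [Real.exp_neg, ← div_eq_mul_inv, le_div_iff₀ hpos]
    exact le_trans h1 h2
  calc _ ≤ _ := h3
    _ = C * Real.exp (-(s ^ 2 / (2 * D))) := by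
        rw [mul_assoc, ← Real.exp_add, ← hkey]; ring_nf

/-- Harmonic sum vs logarithm. [folklore] -/
theorem sum_inv_le_log (n K : ℕ) (hK : K < n) :
    ∑ k ∈ range K, (1 : ℝ) / ((n : ℝ) - k) ≤ Real.log n - Real.log ((n : ℝ) - K) := by
  induction K with
  | zero => simp
  | succ K ih =>
    have hK' : K < n := by omega
    have ih := ih hK'
    rw [Finset.sum_range_succ]
    have hx : (0 : ℝ) < (n : ℝ) - K - 1 := by
      have : (K : ℝ) + 1 < n := by exact_mod_cast hK
      linarith
    have hstep : (1 : ℝ) / ((n : ℝ) - K) ≤ Real.log ((n : ℝ) - K) - Real.log ((n : ℝ) - (K + 1 : ℕ)) := by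
      have hx' : (0 : ℝ) < (n : ℝ) - K := by linarith
      have hq : (0 : ℝ) < ((n : ℝ) - K) / ((n : ℝ) - K - 1) := div_pos hx' hx
      have := Real.one_sub_inv_le_log_of_pos hq
      rw [Real.log_div hx'.ne' hx.ne'] at this
      push_cast
      have e : (1 : ℝ) - (((n : ℝ) - K) / ((n : ℝ) - K - 1))⁻¹ = 1 / ((n : ℝ) - K) := by
        have h1 := hx'.ne'
        have h2 := hx.ne'
        rw [inv_div]
        field_simp
        ring
      rw [e] at this
      convert this using 2; ring
    linarith

/-- Telescoping sum used for the column term. [folklore] -/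
theorem sum_telescope (n K : ℕ) :
    ∑ k ∈ range K, ((1 : ℝ) / ((n : ℝ) - 1 - k) - 1 / ((n : ℝ) - k)) = 1 / ((n : ℝ) - K) - 1 / n := by
  induction K with
  | zero => simp
  | succ K ih =>
    rw [Finset.sum_range_succ, ih]
    push_cast
    ring



/-- Budget bound for a block of `K` rows sorted by decreasing mass. [folklore] -/
theorem W_block_le (n K : ℕ) (s : Fin n → ℝ) (hs0 : ∀ k, 0 ≤ s k)
    (hsK : ∀ k : Fin n, K ≤ (k : ℕ) → s k = 0)
    (hanti : ∀ i j : Fin n, (i : ℕ) ≤ j → (j : ℕ) < K → s j ≤ s i)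
    (hK1 : 1 ≤ K) (hK2 : 2 * K ≤ n + 1) (hKn : K < n) :
    W n K s ≤ (2 * (∑ k, s k) / K) * (Real.log n - Real.log ((n : ℝ) - K))
      + (∑ k, s k) * (1 / ((n : ℝ) - K + 1) - 1 / n) := by
  set S := univ.filter (fun k : Fin n => (k : ℕ) < K) with hS
  set Q := ∑ k, s k with hQ
  have hQ0 : 0 ≤ Q := Finset.sum_nonneg fun k _ => hs0 k
  have hQS : ∑ k ∈ S, s k = Q := by
    rw [hQ]
    apply Finset.sum_subset (Finset.filter_subset _ _)
    intro k _ hk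
    simp only [Finset.mem_filter, Finset.mem_univ, true_and, not_lt] at hk
    exact hsK k hk
  have hcardS : S.card = K := by
    rw [hS, Fin.card_filter_val_lt]; exact min_eq_right hKn.le
  set A : Fin n → ℝ := fun k => 2 / ((n : ℝ) - k) with hA
  set B : Fin n → ℝ := fun k => (((K : ℝ) - 1 - k) / ((n : ℝ) - 1 - k) ^ 2) with hB
  set inner : Fin n → ℝ := fun k => ∑ l : Fin n, if (k : ℕ) < l ∧ (l : ℕ) < K then s l else 0
    with hinner
  have hW : W n K s = ∑ k ∈ S, A k * s k + ∑ k ∈ S, A k * B k * inner k := by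
    unfold W
    rw [← Finset.sum_add_distrib, hS, Finset.sum_filter]
    refine Finset.sum_congr rfl fun k _ => ?_
    split_ifs
    · simp only [hA, hB, hinner]; ring
    · rfl
  -- positivity facts
  have hkn : ∀ k : Fin n, (0 : ℝ) < (n : ℝ) - k := fun k => by
    have : (k : ℝ) < n := by exact_mod_cast k.2
    linarith
  have hA0 : ∀ k, 0 ≤ A k := fun k => div_nonneg (by norm_num) (hkn k).le
  -- T1 via Chebyshev
  have hT1 : ∑ k ∈ S, A k * s k ≤ (2 * Q / K) * (Real.log n - Real.log ((n : ℝ) - K)) := by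
    have hav : AntivaryOn s A S := by
      intro i hi j hj hij
      simp only [hS, Finset.coe_filter, Finset.mem_univ, true_and, Set.mem_setOf_eq] at hi hj
      apply hanti i j _ hj
      by_contra hcon
      have hcon' := not_le.mp hcon
      have : A j ≤ A i := by
        simp only [hA]
        apply div_le_div_of_nonneg_left (by norm_num) (hkn i)
        have : (j : ℝ) ≤ i := by exact_mod_cast hcon'.le
        linarith
      linarith
    have hcheb := hav.card_mul_sum_le_sum_mul_sum
    rw [hcardS, hQS] at hcheb
    have hsumA : ∑ k ∈ S, A k ≤ 2 * (Real.log n - Real.log ((n : ℝ) - K)) := by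
      have h1 : ∑ k ∈ S, A k = ∑ k ∈ range K, 2 / ((n : ℝ) - k) := by
        rw [hS, Finset.sum_filter]
        rw [Fin.sum_univ_eq_sum_range (fun k => if k < K then 2 / ((n : ℝ) - k) else 0) n]
        rw [← Finset.sum_filter]
        congr 1
        ext k; simp; omega
      rw [h1]
      have h2 := sum_inv_le_log n K hKn
      have h3 : ∑ k ∈ range K, 2 / ((n : ℝ) - k) = 2 * ∑ k ∈ range K, 1 / ((n : ℝ) - k) := by
        rw [Finset.mul_sum]; refine Finset.sum_congr rfl fun k _ => ?_; ring
      rw [h3]; linarith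
    have hK0 : (0 : ℝ) < K := by exact_mod_cast hK1
    rw [div_mul_eq_mul_div, le_div_iff₀ hK0]
    calc (∑ k ∈ S, A k * s k) * K = K * ∑ k ∈ S, s k * A k := by
          rw [mul_comm]; congr 1; refine Finset.sum_congr rfl fun k _ => ?_; ring
      _ ≤ Q * ∑ k ∈ S, A k := hcheb
      _ ≤ Q * (2 * (Real.log n - Real.log ((n : ℝ) - K))) := mul_le_mul_of_nonneg_left hsumA hQ0
      _ = 2 * Q * (Real.log n - Real.log ((n : ℝ) - K)) := by ring
  -- T2 via telescoping
  have hT2 : ∑ k ∈ S, A k * B k * inner k ≤ Q * (1 / ((n : ℝ) - K + 1) - 1 / n) := by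
    -- termwise bound
    have hterm : ∀ k ∈ S, A k * B k * inner k ≤
        if (k : ℕ) + 1 < K then Q * (1 / ((n : ℝ) - 1 - k) - 1 / ((n : ℝ) - k)) else 0 := by
      intro k hk
      simp only [hS, Finset.mem_filter, Finset.mem_univ, true_and] at hk
      by_cases hk1 : (k : ℕ) + 1 < K
      · rw [if_pos hk1]
        have hkn1 : (0 : ℝ) < (n : ℝ) - 1 - k := by
          have : (k : ℝ) + 1 < K := by exact_mod_cast hk1
          have : (K : ℝ) ≤ n := by exact_mod_cast hKn.le
          linarith
        have hinner_le : inner k ≤ Q := by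
          simp only [hinner, hQ]
          apply Finset.sum_le_sum
          intro l _
          split_ifs
          · exact le_rfl
          · exact hs0 l
        have hinner0 : 0 ≤ inner k := by
          simp only [hinner]
          apply Finset.sum_nonneg; intro l _; split_ifs; exact hs0 l; exact le_rfl
        have hB_le : B k ≤ 1 / (2 * ((n : ℝ) - 1 - k)) := by
          simp only [hB]
          rw [div_le_div_iff₀ (by positivity) (by positivity)]
          have h2K : (2 : ℝ) * K ≤ n + 1 := by exact_mod_cast hK2
          have hk0 : (0 : ℝ) ≤ k := Nat.cast_nonneg _
          nlinarith
        have hB0 : 0 ≤ B k := by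
          simp only [hB]
          apply div_nonneg _ (sq_nonneg _)
          have : (k : ℝ) + 1 < K := by exact_mod_cast hk1
          linarith
        calc A k * B k * inner k ≤ A k * (1 / (2 * ((n : ℝ) - 1 - k))) * Q := by
              apply mul_le_mul _ hinner_le hinner0
              · exact mul_nonneg (hA0 k) (by positivity)
              · exact mul_le_mul_of_nonneg_left hB_le (hA0 k)
          _ = Q * (1 / ((n : ℝ) - 1 - k) - 1 / ((n : ℝ) - k)) := by
              simp only [hA]
              have h1 := (hkn k).ne'
              have h2 := hkn1.ne'
              field_simp
              ring
      · rw [if_neg hk1]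
        have : inner k = 0 := by
          simp only [hinner]
          apply Finset.sum_eq_zero
          intro l _
          rw [if_neg]
          omega
        rw [this, mul_zero]
    calc ∑ k ∈ S, A k * B k * inner k
        ≤ ∑ k ∈ S, (if (k : ℕ) + 1 < K then Q * (1 / ((n : ℝ) - 1 - k) - 1 / ((n : ℝ) - k)) else 0) :=
          Finset.sum_le_sum hterm
      _ = ∑ k : Fin n, (if (k : ℕ) + 1 < K then Q * (1 / ((n : ℝ) - 1 - k) - 1 / ((n : ℝ) - k)) else 0) := by
          apply Finset.sum_subset (Finset.filter_subset _ _)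
          intro k _ hk
          simp only [Finset.mem_filter, Finset.mem_univ, true_and, not_lt] at hk
          rw [if_neg (by omega)]
      _ = ∑ k ∈ range (K - 1), Q * (1 / ((n : ℝ) - 1 - k) - 1 / ((n : ℝ) - k)) := by
          rw [Fin.sum_univ_eq_sum_range
            (fun k => if k + 1 < K then Q * (1 / ((n : ℝ) - 1 - k) - 1 / ((n : ℝ) - k)) else 0) n]
          rw [← Finset.sum_filter]
          congr 1
          ext k; simp; omega
      _ = Q * (1 / ((n : ℝ) - K + 1) - 1 / n) := by
          rw [← Finset.mul_sum, sum_telescope]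
          congr 2
          rw [Nat.cast_sub hK1, Nat.cast_one]; ring
  rw [hW]
  linarith

/-- Numerical budget inequality for the heavy block (`α = 3/5`): `4(log 2 + 1/(n-1)) + 1 ≤
8·(3/5)²·θ` for `n ≥ 4`, from `log 2 < 0.6931471808` and `log 3 > 1`. [folklore] -/
theorem budgetA (n : ℕ) (hn : 4 ≤ n) :
    4 * (Real.log 2 + 1 / ((n : ℝ) - 1)) + 1 ≤
      8 * (3 / 5 : ℝ) ^ 2 * (5 / 2 * Real.log 3 - 2 / 3) := by
  have h2 := Real.log_two_lt_d9
  have h3 : (1 : ℝ) < Real.log 3 := ((Real.lt_log_iff_exp_lt (by norm_num)).mpr Real.exp_one_lt_three)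
  have hn' : (4 : ℝ) ≤ n := by exact_mod_cast hn
  have : 1 / ((n : ℝ) - 1) ≤ 1 / 3 := by
    apply div_le_div_of_nonneg_left (by norm_num) (by norm_num) (by linarith)
  nlinarith

/-- Numerical budget inequality for the light block (`1 - α = 2/5`): `2 log 2 + 1/2 ≤ 8·(2/5)²·θ`.
[folklore] -/
theorem budgetB : 2 * Real.log 2 + 1 / 2 ≤ 8 * (2 / 5 : ℝ) ^ 2 * (5 / 2 * Real.log 3 - 2 / 3) := by
  have h2 := Real.log_two_lt_d9
  have h3 : (1 : ℝ) < Real.log 3 := ((Real.lt_log_iff_exp_lt (by norm_num)).mpr Real.exp_one_lt_three)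
  nlinarith


/-! ### From the core bound to tails of blocks -/

variable {n : ℕ}

/-- MGF bound in the form needed by the tail lemma. [folklore] -/
theorem mgf_of_core (c : Fin n → Fin n → ℝ) (K : ℕ) {m V bstar : ℝ} (hm0 : 0 ≤ m)
    (hzero : ∀ i : Fin n, K ≤ (i : ℕ) → ∀ j, c i j = 0) (hm : ∀ i j, |c i j| ≤ m)
    (hK : 2 * K ≤ n + 1) (hWV : W n K (rowMass c) ≤ V) (hb : 3 * m ≤ bstar) :
    ∀ lam : ℝ, 0 ≤ lam → lam * bstar < 3 →
      ∑ σ : Perm (Fin n), Real.exp (lam * (Z c σ - mean c)) ≤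
        (n.factorial : ℝ) * Real.exp (lam ^ 2 / (2 * (1 - lam * bstar / 3)) * V) := by
  intro lam hl hlb
  have hlb' : lam * (3 * m) < 3 := lt_of_le_of_lt (mul_le_mul_of_nonneg_left hb hl) hlb
  have hbK : 2 * m * ((n : ℝ) - 1) + 2 * m * ((K : ℝ) - 1) ≤ 3 * m * ((n : ℝ) - 1) := by
    have : (2 : ℝ) * K ≤ n + 1 := by exact_mod_cast hK
    nlinarith
  have h := core n c K m (3 * m) lam hzero hm hm0 (by linarith) (by linarith) hbK hl hlb'
  refine le_trans h ?_
  apply mul_le_mul_of_nonneg_left _ (Nat.cast_nonneg _)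
  apply Real.exp_le_exp.mpr
  have hW0 : 0 ≤ W n K (rowMass c) := W_nonneg _ _ _ (rowMass_nonneg c)
  have hd1 : 0 < 1 - lam * bstar / 3 := by linarith
  calc lam ^ 2 / (2 * (1 - lam * (3 * m) / 3)) * W n K (rowMass c)
      ≤ lam ^ 2 / (2 * (1 - lam * bstar / 3)) * W n K (rowMass c) := by
        apply mul_le_mul_of_nonneg_right _ hW0
        apply div_le_div_of_nonneg_left (sq_nonneg _) (by positivity)
        nlinarith
    _ ≤ lam ^ 2 / (2 * (1 - lam * bstar / 3)) * V :=
        mul_le_mul_of_nonneg_left hWV (by positivity)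

/-- One-sided tail of a block in counting form. [folklore] -/
theorem tail_core (c : Fin n → Fin n → ℝ) (K : ℕ) {m V bstar s : ℝ} (hm0 : 0 ≤ m)
    (hzero : ∀ i : Fin n, K ≤ (i : ℕ) → ∀ j, c i j = 0) (hm : ∀ i j, |c i j| ≤ m)
    (hK : 2 * K ≤ n + 1) (hV : 0 < V) (hWV : W n K (rowMass c) ≤ V) (hb : 3 * m ≤ bstar)
    (hs : 0 ≤ s) :
    ((univ.filter fun σ : Perm (Fin n) => s ≤ Z c σ - mean c).card : ℝ) ≤
      (n.factorial : ℝ) * Real.exp (-(s ^ 2 / (2 * (V + bstar * s / 3)))) :=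
  card_tail_le_of_mgf (fun σ => Z c σ - mean c) hV (by linarith)
    (mgf_of_core c K hm0 hzero hm hK hWV hb) hs

/-! ### Blocks -/

/-- The block array: rows `e 0, …, e (K-1)` of `a`, zero rows below. [folklore] -/
def block (a : Fin n → Fin n → ℝ) (e : Fin n → Fin n) (K : ℕ) : Fin n → Fin n → ℝ :=
  fun i j => if (i : ℕ) < K then a (e i) j else 0

/-- Rows of a block beyond `K` vanish. [folklore] -/
theorem block_zero (a : Fin n → Fin n → ℝ) (e : Fin n → Fin n) (K : ℕ) :
    ∀ i : Fin n, K ≤ (i : ℕ) → ∀ j, block a e K i j = 0 := by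
  intro i hi j; simp only [block, if_neg (not_lt.mpr hi)]

/-- Entries of a block are bounded like those of the array. [folklore] -/
theorem abs_block_le (a : Fin n → Fin n → ℝ) (e : Fin n → Fin n) (K : ℕ) {m : ℝ}
    (hm : ∀ i j, |a i j| ≤ m) (hm0 : 0 ≤ m) : ∀ i j, |block a e K i j| ≤ m := by
  intro i j; unfold block
  split_ifs
  · exact hm _ _
  · simpa using hm0

/-- Row masses of a block. [folklore] -/
theorem rowMass_block (a : Fin n → Fin n → ℝ) (e : Fin n → Fin n) (K : ℕ) (i : Fin n) :
    rowMass (block a e K) i = if (i : ℕ) < K then rowMass a (e i) else 0 := by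
  unfold rowMass block
  by_cases h : (i : ℕ) < K
  · simp only [if_pos h]
  · simp only [if_neg h]; simp

/-- Permuted sum of a block. [folklore] -/
theorem Z_block (a : Fin n → Fin n → ℝ) (e : Fin n → Fin n) (K : ℕ) (σ : Perm (Fin n)) :
    Z (block a e K) σ = ∑ i : Fin n, if (i : ℕ) < K then a (e i) (σ i) else 0 := by
  unfold Z block; rfl

/-- Mean of a block. [folklore] -/
theorem mean_block (a : Fin n → Fin n → ℝ) (e : Fin n → Fin n) (K : ℕ) :
    mean (block a e K) = (∑ i : Fin n, if (i : ℕ) < K then ∑ j, a (e i) j else 0) / n := by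
  unfold mean block
  congr 1
  refine Finset.sum_congr rfl fun i _ => ?_
  split_ifs <;> simp

/-- Negated array. [folklore] -/
def negArr (c : Fin n → Fin n → ℝ) : Fin n → Fin n → ℝ := fun i j => -c i j

/-- Permuted sum of the negated array. [folklore] -/
theorem Z_negArr (c : Fin n → Fin n → ℝ) (σ : Perm (Fin n)) : Z (negArr c) σ = -Z c σ := by
  simp [Z, negArr]

/-- Mean of the negated array. [folklore] -/
theorem mean_negArr (c : Fin n → Fin n → ℝ) : mean (negArr c) = -mean c := by
  simp [mean, negArr, neg_div]

/-- Row masses of the negated array. [folklore] -/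
theorem rowMass_negArr (c : Fin n → Fin n → ℝ) : rowMass (negArr c) = rowMass c := by
  funext i; simp [rowMass, negArr]

/-- Blocks commute with negation. [folklore] -/
theorem block_negArr (a : Fin n → Fin n → ℝ) (e : Fin n → Fin n) (K : ℕ) :
    block (negArr a) e K = negArr (block a e K) := by
  funext i j
  by_cases h : (i : ℕ) < K
  · simp only [block, negArr, if_pos h]
  · simp only [block, negArr, if_neg h, neg_zero]

/-- Re-indexing permutations by a fixed permutation does not change counts. [folklore] -/
theorem card_filter_trans (e₀ : Perm (Fin n)) (P : Perm (Fin n) → Prop) [DecidablePred P] :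
    (univ.filter fun σ => P (e₀.trans σ)).card = (univ.filter P).card := by
  apply Finset.card_bij (fun σ _ => e₀.trans σ)
  · intro σ hσ; simpa using hσ
  · intro σ₁ _ σ₂ _ h
    have := congrArg (fun x => e₀.symm.trans x) h
    simpa [← Equiv.trans_assoc] using this
  · intro σ' hσ'
    refine ⟨e₀.symm.trans σ', ?_, ?_⟩
    · simp only [Finset.mem_filter, Finset.mem_univ, true_and] at hσ' ⊢
      simpa [← Equiv.trans_assoc] using hσ'
    · simp [← Equiv.trans_assoc]

/-- Two-sided tail of a re-indexed block. [folklore] -/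
theorem two_sided_block_tail (a : Fin n → Fin n → ℝ) (e : Fin n → Fin n) (K : ℕ)
    (e₀ : Perm (Fin n)) {m V bstar s : ℝ} (hm0 : 0 ≤ m) (hm : ∀ i j, |a i j| ≤ m)
    (hK : 2 * K ≤ n + 1) (hV : 0 < V) (hWV : W n K (rowMass (block a e K)) ≤ V)
    (hb : 3 * m ≤ bstar) (hs : 0 ≤ s) :
    ((univ.filter fun σ : Perm (Fin n) =>
        s ≤ Z (block a e K) (e₀.trans σ) - mean (block a e K)).card : ℝ) +
      ((univ.filter fun σ : Perm (Fin n) =>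
        s ≤ -(Z (block a e K) (e₀.trans σ) - mean (block a e K))).card : ℝ) ≤
      2 * ((n.factorial : ℝ) * Real.exp (-(s ^ 2 / (2 * (V + bstar * s / 3))))) := by
  have h1 := tail_core (block a e K) K hm0 (block_zero a e K) (abs_block_le a e K hm hm0)
    hK hV hWV hb hs
  have h2 := tail_core (block (negArr a) e K) K hm0 (block_zero _ e K)
    (abs_block_le _ e K (by intro i j; simpa [negArr] using hm i j) hm0) hK hV
    (by rwa [block_negArr, rowMass_negArr]) hb hs
  rw [card_filter_trans e₀ (fun σ => s ≤ Z (block a e K) σ - mean (block a e K))]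
  rw [card_filter_trans e₀ (fun σ => s ≤ -(Z (block a e K) σ - mean (block a e K)))]
  have h3 : (univ.filter fun σ : Perm (Fin n) => s ≤ -(Z (block a e K) σ - mean (block a e K)))
      = (univ.filter fun σ : Perm (Fin n) =>
          s ≤ Z (block (negArr a) e K) σ - mean (block (negArr a) e K)) := by
    congr 1; ext σ
    rw [block_negArr, Z_negArr, mean_negArr]; ring_nf
  rw [h3]
  linarith

/-! ### Sorting rows and the index shift -/

/-- Arithmetic of the shift `i ↦ i + K_A` in `Fin n` (`n = K_A + K_B`): it lands in `[K_A, n)`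
exactly on `i < K_B`, where it is `i + K_A`. [folklore] -/
theorem val_add_iff {KA KB : ℕ} (hn : KA + KB = n) (kA : Fin n) (hkA : (kA : ℕ) = KA)
    (i : Fin n) :
    (KA ≤ ((i + kA : Fin n) : ℕ) ↔ (i : ℕ) < KB) ∧
      ((i : ℕ) < KB → ((i + kA : Fin n) : ℕ) = (i : ℕ) + KA) := by
  have hv : ((i + kA : Fin n) : ℕ) = ((i : ℕ) + (kA : ℕ)) % n := Fin.val_add _ _
  rw [hkA] at hv
  have hi := i.2
  refine ⟨⟨fun h => ?_, fun h => ?_⟩, fun h => ?_⟩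
  · by_contra hcon
    have h1 : n ≤ (i : ℕ) + KA := by omega
    rw [hv, Nat.mod_eq_sub_mod h1, Nat.mod_eq_of_lt (by omega)] at h
    omega
  · rw [hv, Nat.mod_eq_of_lt (by omega)]; omega
  · rw [hv, Nat.mod_eq_of_lt (by omega)]

/-- Splitting a sum over rows into the two blocks. [folklore] -/
theorem sum_split [NeZero n] {KA KB : ℕ} (hn : KA + KB = n) (kA : Fin n) (hkA : (kA : ℕ) = KA)
    (ρ : Perm (Fin n)) (f : Fin n → ℝ) :
    ∑ i, f i = (∑ i : Fin n, if (i : ℕ) < KA then f (ρ i) else 0) +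
      ∑ i : Fin n, if (i : ℕ) < KB then f (ρ (i + kA)) else 0 := by
  rw [← Equiv.sum_comp ρ f]
  have h1 : ∑ i, f (ρ i) = (∑ i : Fin n, if (i : ℕ) < KA then f (ρ i) else 0) +
      ∑ i : Fin n, if (i : ℕ) < KA then 0 else f (ρ i) := by
    rw [← Finset.sum_add_distrib]
    refine Finset.sum_congr rfl fun i _ => ?_
    split_ifs <;> simp
  rw [h1]
  congr 1
  rw [← Equiv.sum_comp (Equiv.addRight kA) (fun i => if (i : ℕ) < KA then 0 else f (ρ i))]
  refine Finset.sum_congr rfl fun i _ => ?_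
  simp only [Equiv.coe_addRight]
  obtain ⟨h2, -⟩ := val_add_iff hn kA hkA i
  by_cases hi : (i : ℕ) < KB
  · rw [if_pos hi, if_neg (by have := h2.mpr hi; omega)]
  · rw [if_neg hi, if_pos (by have := (not_iff_not.mpr h2).mpr hi; omega)]

/-- The decomposition `Z - EZ = A + B` along the two blocks. [folklore] -/
theorem decomp [NeZero n] (a : Fin n → Fin n → ℝ) {KA KB : ℕ} (hn : KA + KB = n) (kA : Fin n)
    (hkA : (kA : ℕ) = KA) (ρ σ : Perm (Fin n)) :
    Z a σ - mean a =
      (Z (block a ρ KA) (ρ.trans σ) - mean (block a ρ KA)) +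
      (Z (block a (fun i => ρ (i + kA)) KB) (((Equiv.addRight kA).trans ρ).trans σ) -
        mean (block a (fun i => ρ (i + kA)) KB)) := by
  have hZ := sum_split hn kA hkA ρ (fun i => a i (σ i))
  have hM := sum_split hn kA hkA ρ (fun i => ∑ j, a i j)
  simp only [Z_block, mean_block]
  unfold Z mean
  rw [hZ, hM, add_div]
  simp only [Equiv.trans_apply, Equiv.coe_addRight]
  ring

/-- The lightest `KB` rows carry at most their share of the mass. [folklore] -/
theorem light_rows (s : Fin n → ℝ) (hanti : ∀ i j : Fin n, i ≤ j → s j ≤ s i)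
    {KA KB : ℕ} (hn : KA + KB = n) (kA : Fin n) (hkA : (kA : ℕ) = KA) (hKA1 : 1 ≤ KA) :
    (n : ℝ) * (∑ i : Fin n, if (i : ℕ) < KB then s (i + kA) else 0) ≤
      KB * ((∑ i : Fin n, if (i : ℕ) < KA then s i else 0) +
        ∑ i : Fin n, if (i : ℕ) < KB then s (i + kA) else 0) := by
  have hKA1' : KA - 1 < n := by omega
  have hKAn : KA ≤ n := by omega
  have hKBn : KB ≤ n := by omega
  set sstar := s ⟨KA - 1, hKA1'⟩ with hsstar
  set QA := ∑ i : Fin n, if (i : ℕ) < KA then s i else 0 with hQA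
  set QB := ∑ i : Fin n, if (i : ℕ) < KB then s (i + kA) else 0 with hQB
  have hB : QB ≤ KB * sstar := by
    rw [hQB, ← Finset.sum_filter]
    calc ∑ i ∈ univ.filter (fun i : Fin n => (i : ℕ) < KB), s (i + kA)
        ≤ ∑ _i ∈ univ.filter (fun i : Fin n => (i : ℕ) < KB), sstar := by
          apply Finset.sum_le_sum
          intro i hi
          simp only [Finset.mem_filter, Finset.mem_univ, true_and] at hi
          apply hanti
          rw [Fin.le_def]
          have := (val_add_iff hn kA hkA i).2 hi
          simp only
          omega
      _ = KB * sstar := by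
          simp [Finset.sum_const, Fin.card_filter_val_lt, min_eq_right hKBn]
  have hA : KA * sstar ≤ QA := by
    rw [hQA, ← Finset.sum_filter]
    calc (KA : ℝ) * sstar = ∑ _i ∈ univ.filter (fun i : Fin n => (i : ℕ) < KA), sstar := by
          simp [Finset.sum_const, Fin.card_filter_val_lt, min_eq_right hKAn]
      _ ≤ ∑ i ∈ univ.filter (fun i : Fin n => (i : ℕ) < KA), s i := by
          apply Finset.sum_le_sum
          intro i hi
          simp only [Finset.mem_filter, Finset.mem_univ, true_and] at hi
          apply hanti
          rw [Fin.le_def]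
          simp only
          omega
  have hKA0 : (0 : ℝ) ≤ KA := Nat.cast_nonneg _
  have hKB0 : (0 : ℝ) ≤ KB := Nat.cast_nonneg _
  have hnn : (n : ℝ) = KA + KB := by exact_mod_cast hn.symm
  rw [hnn]
  nlinarith [mul_le_mul_of_nonneg_left hB hKA0, mul_le_mul_of_nonneg_left hA hKB0]

/-! ### Real-arithmetic budget estimates -/

/-- The budget of the heavy block fits into `8 α² θ v` with `α = 3/5` (`n ≥ 4`). [folklore] -/
theorem WA_le {n KA KB : ℕ} {Q QA Wv : ℝ} (hn4 : 4 ≤ n) (hKAB : KA + KB = n)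
    (hKA : n ≤ 2 * KA) (hKA2 : 2 * KA ≤ n + 1) (hKA1 : 1 ≤ KA) (hKB1 : 1 ≤ KB)
    (hQA0 : 0 ≤ QA) (hQAQ : QA ≤ Q)
    (hW : Wv ≤ (2 * QA / KA) * (Real.log n - Real.log ((n : ℝ) - KA))
      + QA * (1 / ((n : ℝ) - KA + 1) - 1 / n)) :
    Wv ≤ 8 * (3 / 5 : ℝ) ^ 2 * (5 / 2 * Real.log 3 - 2 / 3) * (Q / n) := by
  have hn' : (4 : ℝ) ≤ n := by exact_mod_cast hn4
  have hn0 : (0 : ℝ) < n := by linarith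
  have hn1 : (0 : ℝ) < (n : ℝ) - 1 := by linarith
  have hKAr : (n : ℝ) ≤ 2 * KA := by exact_mod_cast hKA
  have hKA2r : 2 * (KA : ℝ) ≤ n + 1 := by exact_mod_cast hKA2
  have hKAB' : (KA : ℝ) + KB = n := by exact_mod_cast hKAB
  have hKA0 : (0 : ℝ) < KA := by exact_mod_cast hKA1
  have hKB0 : (0 : ℝ) < KB := by exact_mod_cast hKB1
  have hKA1r : (1 : ℝ) ≤ KA := by exact_mod_cast hKA1
  have hQ0 : 0 ≤ Q := le_trans hQA0 hQAQ
  have e1 : (n : ℝ) - KA = KB := by linarith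
  have htwo : (2 : ℝ) / n = 2 * (1 / n) := by ring
  rw [e1] at hW
  -- log estimate
  have hlog : Real.log n - Real.log KB ≤ Real.log 2 + 1 / ((n : ℝ) - 1) := by
    rw [← Real.log_div hn0.ne' hKB0.ne']
    have hq : (0 : ℝ) < (n : ℝ) / ((n : ℝ) - 1) := div_pos hn0 hn1
    have h1 : (n : ℝ) / KB ≤ 2 * ((n : ℝ) / ((n : ℝ) - 1)) := by
      rw [mul_div_assoc', div_le_div_iff₀ hKB0 hn1]
      have h5 : (n : ℝ) - 1 ≤ 2 * KB := by linarith
      nlinarith [mul_le_mul_of_nonneg_left h5 hn0.le]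
    have h2 : Real.log ((n : ℝ) / KB) ≤ Real.log (2 * ((n : ℝ) / ((n : ℝ) - 1))) :=
      Real.log_le_log (div_pos hn0 hKB0) h1
    have h3 : Real.log (2 * ((n : ℝ) / ((n : ℝ) - 1))) =
        Real.log 2 + Real.log ((n : ℝ) / ((n : ℝ) - 1)) :=
      Real.log_mul (by norm_num) hq.ne'
    have h4 : Real.log ((n : ℝ) / ((n : ℝ) - 1)) ≤ 1 / ((n : ℝ) - 1) := by
      have h5 := Real.log_le_sub_one_of_pos hq
      have h6 : (n : ℝ) / ((n : ℝ) - 1) - 1 = 1 / ((n : ℝ) - 1) := by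
        field_simp; ring
      linarith
    linarith
  have hL0 : 0 ≤ Real.log n - Real.log KB := by
    rw [sub_nonneg]; exact Real.log_le_log hKB0 (by linarith)
  have hD : 1 / ((KB : ℝ) + 1) - 1 / n ≤ 1 / n := by
    have : 1 / ((KB : ℝ) + 1) ≤ 2 / n := by
      rw [div_le_div_iff₀ (by positivity) hn0]; linarith
    linarith
  have hD0 : 0 ≤ 1 / ((KB : ℝ) + 1) - 1 / n := by
    rw [sub_nonneg]
    exact div_le_div_of_nonneg_left (by norm_num) (by positivity) (by linarith)
  have hpos : 0 ≤ Real.log 2 + 1 / ((n : ℝ) - 1) := by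
    have := Real.log_two_gt_d9
    have : 0 ≤ 1 / ((n : ℝ) - 1) := by positivity
    linarith
  have hbud := budgetA n hn4
  calc Wv ≤ (2 * QA / KA) * (Real.log n - Real.log KB) + QA * (1 / ((KB : ℝ) + 1) - 1 / n) := hW
    _ ≤ (2 * Q / KA) * (Real.log 2 + 1 / ((n : ℝ) - 1)) + Q * (1 / n) := by
        apply add_le_add
        · apply mul_le_mul _ hlog hL0 (by positivity)
          exact div_le_div_of_nonneg_right (by linarith) hKA0.le
        · exact mul_le_mul hQAQ hD hD0 hQ0
    _ ≤ (4 * Q / n) * (Real.log 2 + 1 / ((n : ℝ) - 1)) + Q * (1 / n) := by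
        apply add_le_add _ le_rfl
        apply mul_le_mul_of_nonneg_right _ hpos
        rw [div_le_div_iff₀ hKA0 hn0]; nlinarith
    _ = (4 * (Real.log 2 + 1 / ((n : ℝ) - 1)) + 1) * (Q / n) := by ring
    _ ≤ 8 * (3 / 5 : ℝ) ^ 2 * (5 / 2 * Real.log 3 - 2 / 3) * (Q / n) :=
        mul_le_mul_of_nonneg_right hbud (div_nonneg hQ0 hn0.le)

/-- The budget of the light block fits into `8 (1-α)² θ v` with `1 - α = 2/5` (`n ≥ 4`). [folklore]
-/
theorem WB_le {n KA KB : ℕ} {Q QB Wv : ℝ} (hn4 : 4 ≤ n) (hKAB : KA + KB = n)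
    (hKA : n ≤ 2 * KA) (hKB : 2 * KB ≤ n) (hKA1 : 1 ≤ KA) (hKB1 : 1 ≤ KB) (hQ0 : 0 ≤ Q)
    (hlight : (n : ℝ) * QB ≤ KB * Q)
    (hW : Wv ≤ (2 * QB / KB) * (Real.log n - Real.log ((n : ℝ) - KB))
      + QB * (1 / ((n : ℝ) - KB + 1) - 1 / n)) :
    Wv ≤ 8 * (2 / 5 : ℝ) ^ 2 * (5 / 2 * Real.log 3 - 2 / 3) * (Q / n) := by
  have hn' : (4 : ℝ) ≤ n := by exact_mod_cast hn4
  have hn0 : (0 : ℝ) < n := by linarith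
  have hKAr : (n : ℝ) ≤ 2 * KA := by exact_mod_cast hKA
  have hKBr : 2 * (KB : ℝ) ≤ n := by exact_mod_cast hKB
  have hKAB' : (KA : ℝ) + KB = n := by exact_mod_cast hKAB
  have hKA0 : (0 : ℝ) < KA := by exact_mod_cast hKA1
  have hKB0 : (0 : ℝ) < KB := by exact_mod_cast hKB1
  have hKB1r : (1 : ℝ) ≤ KB := by exact_mod_cast hKB1
  have e1 : (n : ℝ) - KB = KA := by linarith
  have htwo : (2 : ℝ) / n = 2 * (1 / n) := by ring
  rw [e1] at hW
  have hlogB : Real.log n - Real.log KA ≤ Real.log 2 := by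
    rw [← Real.log_div hn0.ne' hKA0.ne']
    apply Real.log_le_log (div_pos hn0 hKA0)
    rw [div_le_iff₀ hKA0]; linarith
  have hL0 : 0 ≤ Real.log n - Real.log KA := by
    rw [sub_nonneg]; exact Real.log_le_log hKA0 (by linarith)
  have hQBQ : QB ≤ Q / 2 := by
    rw [le_div_iff₀ (by norm_num : (0:ℝ) < 2)]
    nlinarith
  have hQBn : 2 * QB / KB ≤ 2 * (Q / n) := by
    have : QB / KB ≤ Q / n := by
      rw [div_le_div_iff₀ hKB0 hn0]; linarith
    rw [mul_div_assoc]; linarith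
  have hD : 1 / ((KA : ℝ) + 1) - 1 / n ≤ 1 / n := by
    have : 1 / ((KA : ℝ) + 1) ≤ 2 / n := by
      rw [div_le_div_iff₀ (by positivity) hn0]; linarith
    linarith
  have hD0 : 0 ≤ 1 / ((KA : ℝ) + 1) - 1 / n := by
    rw [sub_nonneg]
    exact div_le_div_of_nonneg_left (by norm_num) (by positivity) (by linarith)
  have hl2 : 0 ≤ Real.log 2 := by have := Real.log_two_gt_d9; linarith
  have hbud := budgetB
  calc Wv ≤ (2 * QB / KB) * (Real.log n - Real.log KA) + QB * (1 / ((KA : ℝ) + 1) - 1 / n) := hW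
    _ ≤ (2 * (Q / n)) * Real.log 2 + (Q / 2) * (1 / n) := by
        apply add_le_add
        · exact mul_le_mul hQBn hlogB hL0 (by positivity)
        · exact mul_le_mul hQBQ hD hD0 (by positivity)
    _ = (2 * Real.log 2 + 1 / 2) * (Q / n) := by ring
    _ ≤ 8 * (2 / 5 : ℝ) ^ 2 * (5 / 2 * Real.log 3 - 2 / 3) * (Q / n) :=
        mul_le_mul_of_nonneg_right hbud (div_nonneg hQ0 hn0.le)

/-! ### The union bound and the small case -/

/-- `{t ≤ |A + B|} ⊆ {3t/5 ≤ A} ∪ {3t/5 ≤ -A} ∪ {2t/5 ≤ B} ∪ {2t/5 ≤ -B}` and the resulting bound on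
cardinalities. [folklore] -/
theorem union_four (X XA XB : Perm (Fin n) → ℝ) (hX : ∀ σ, X σ = XA σ + XB σ) (t B : ℝ)
    (hA : ((univ.filter fun σ => 3 / 5 * t ≤ XA σ).card : ℝ) +
      ((univ.filter fun σ => 3 / 5 * t ≤ -XA σ).card : ℝ) ≤ 2 * B)
    (hB : ((univ.filter fun σ => 2 / 5 * t ≤ XB σ).card : ℝ) +
      ((univ.filter fun σ => 2 / 5 * t ≤ -XB σ).card : ℝ) ≤ 2 * B) :
    ((univ.filter fun σ => t ≤ |X σ|).card : ℝ) ≤ 4 * B := by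
  have hsub : (univ.filter fun σ => t ≤ |X σ|) ⊆
      (((univ.filter fun σ => 3 / 5 * t ≤ XA σ) ∪ (univ.filter fun σ => 3 / 5 * t ≤ -XA σ)) ∪
        (univ.filter fun σ => 2 / 5 * t ≤ XB σ)) ∪
        (univ.filter fun σ => 2 / 5 * t ≤ -XB σ) := by
    intro σ hσ
    simp only [Finset.mem_filter, Finset.mem_univ, true_and] at hσ
    rw [hX σ] at hσ
    simp only [Finset.mem_union, Finset.mem_filter, Finset.mem_univ, true_and]
    by_contra hcon
    simp only [not_or, not_le] at hcon
    obtain ⟨⟨⟨h1, h2⟩, h3⟩, h4⟩ := hcon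
    have hh : |XA σ + XB σ| < t := abs_lt.mpr ⟨by linarith, by linarith⟩
    linarith
  have h1 := Finset.card_le_card hsub
  have h2 := Finset.card_union_le
    (((univ.filter fun σ => 3 / 5 * t ≤ XA σ) ∪ (univ.filter fun σ => 3 / 5 * t ≤ -XA σ)) ∪
        (univ.filter fun σ => 2 / 5 * t ≤ XB σ))
    (univ.filter fun σ => 2 / 5 * t ≤ -XB σ)
  have h3 := Finset.card_union_le
    ((univ.filter fun σ => 3 / 5 * t ≤ XA σ) ∪ (univ.filter fun σ => 3 / 5 * t ≤ -XA σ))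
    (univ.filter fun σ => 2 / 5 * t ≤ XB σ)
  have h4 := Finset.card_union_le
    (univ.filter fun σ => 3 / 5 * t ≤ XA σ) (univ.filter fun σ => 3 / 5 * t ≤ -XA σ)
  have h5 : ((univ.filter fun σ => t ≤ |X σ|).card : ℝ) ≤
      ((((univ.filter fun σ => 3 / 5 * t ≤ XA σ).card +
        (univ.filter fun σ => 3 / 5 * t ≤ -XA σ).card) +
        (univ.filter fun σ => 2 / 5 * t ≤ XB σ).card) +
        (univ.filter fun σ => 2 / 5 * t ≤ -XB σ).card : ℕ) := by
    exact_mod_cast (by omega)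
  push_cast at h5
  linarith

/-- `|Z - EZ| ≤ 2 n m` for an array bounded by `m`. [folklore] -/
theorem abs_Z_sub_mean_le (a : Fin n → Fin n → ℝ) {m : ℝ} (hm : ∀ i j, |a i j| ≤ m)
    (σ : Perm (Fin n)) : |Z a σ - mean a| ≤ 2 * n * m := by
  have hZ : |Z a σ| ≤ n * m := by
    unfold Z
    calc |∑ i, a i (σ i)| ≤ ∑ i, |a i (σ i)| := Finset.abs_sum_le_sum_abs _ _
      _ ≤ ∑ _i : Fin n, m := Finset.sum_le_sum fun i _ => hm _ _
      _ = n * m := by simp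
  have hmean : |mean a| ≤ n * m := by
    unfold mean
    rcases Nat.eq_zero_or_pos n with hn | hn
    · subst hn; simp
    · have hn' : (0 : ℝ) < n := by exact_mod_cast hn
      rw [abs_div, Nat.abs_cast, div_le_iff₀ hn']
      calc |∑ i, ∑ j, a i j| ≤ ∑ i, |∑ j, a i j| := Finset.abs_sum_le_sum_abs _ _
        _ ≤ ∑ i, ∑ j, |a i j| := Finset.sum_le_sum fun i _ => Finset.abs_sum_le_sum_abs _ _
        _ ≤ ∑ _i : Fin n, ∑ _j : Fin n, m := by
            apply Finset.sum_le_sum; intro i _; apply Finset.sum_le_sum; intro j _; exact hm i j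
        _ = n * m * n := by simp; ring
  calc |Z a σ - mean a| ≤ |Z a σ| + |mean a| := abs_sub _ _
    _ ≤ n * m + n * m := add_le_add hZ hmean
    _ = 2 * n * m := by ring

/-- If `E ≤ 2 log 2` then `4 C e^{-E} ≥ C`. [folklore] -/
theorem small_case {C E c : ℝ} (hC : 0 ≤ C) (hc : c ≤ C) (hE : E ≤ 2 * Real.log 2) :
    c ≤ 4 * C * Real.exp (-E) := by
  have h4 : Real.exp (-(2 * Real.log 2)) = 1 / 4 := by
    have : (2 : ℝ) * Real.log 2 = Real.log 4 := by
      rw [show (4 : ℝ) = 2 ^ 2 by norm_num, Real.log_pow]; norm_num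
    rw [this, Real.exp_neg, Real.exp_log (by norm_num)]
    norm_num
  have hexp : (1 : ℝ) / 4 ≤ Real.exp (-E) := by
    rw [← h4]; exact Real.exp_le_exp.mpr (by linarith)
  nlinarith

/-! ### The main theorem -/

/-- **Bernstein's inequality for randomly permuted sums**, counting form with the definitions of
this file (`Z`, `mean`): `#{π : t ≤ |Z_a(π) - E Z_a|} ≤ 4·n!·exp(-t²/(16(θ n⁻¹ Σ a² + m t/3)))`.
Bercu–Delyon–Rio 2015 (martingale proof, reconstructed: see the module docstring); statement as
quoted in Albert 2019, Thm. 1.5. [cite: Albert2019, Thm. 1.5] -/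
theorem main_bound (n : ℕ) (m : ℝ) (a : Fin n → Fin n → ℝ) (hm : ∀ i j, |a i j| ≤ m)
    (t : ℝ) (ht : 0 < t) :
    ((univ.filter fun σ : Perm (Fin n) => t ≤ |Z a σ - mean a|).card : ℝ) ≤
      4 * (n.factorial : ℝ) *
        Real.exp (-(t ^ 2 / (16 * ((5 / 2 * Real.log 3 - 2 / 3) * ((∑ i, ∑ j, a i j ^ 2) / n) +
          m * t / 3)))) := by
  set θ : ℝ := 5 / 2 * Real.log 3 - 2 / 3 with hθ
  have hθ0 : 0 < θ := by
    have : (1 : ℝ) < Real.log 3 := ((Real.lt_log_iff_exp_lt (by norm_num)).mpr Real.exp_one_lt_three)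
    rw [hθ]; linarith
  set Q : ℝ := ∑ i, ∑ j, a i j ^ 2 with hQ
  have hQ' : Q = ∑ i, rowMass a i := by simp [hQ, rowMass]
  have hQ0 : 0 ≤ Q := by rw [hQ']; exact Finset.sum_nonneg fun i _ => rowMass_nonneg a i
  set S := univ.filter fun σ : Perm (Fin n) => t ≤ |Z a σ - mean a| with hS
  set E : ℝ := t ^ 2 / (16 * (θ * (Q / n) + m * t / 3)) with hE
  -- empty case
  rcases S.eq_empty_or_nonempty with hSe | ⟨σ₀, hσ₀⟩
  · rw [hSe]; simp; positivity
  have ht0 : t ≤ |Z a σ₀ - mean a| := by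
    simp only [hS, Finset.mem_filter, Finset.mem_univ, true_and] at hσ₀; exact hσ₀
  have htnm : t ≤ 2 * n * m := le_trans ht0 (abs_Z_sub_mean_le a hm σ₀)
  have hn1 : 1 ≤ n := by
    rcases Nat.eq_zero_or_pos n with hn | hn
    · subst hn; simp at htnm; linarith
    · exact hn
  have hn0 : (0 : ℝ) < n := by exact_mod_cast hn1
  have hm0 : 0 < m := by
    by_contra hcon
    have : m ≤ 0 := not_lt.mp hcon
    nlinarith
  -- Q > 0
  have hQpos : 0 < Q := by
    rcases hQ0.lt_or_eq with h | h
    · exact h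
    · exfalso
      have hzero : ∀ i j, a i j = 0 := by
        intro i j
        have h1 : ∑ i, rowMass a i = 0 := by rw [← hQ']; exact h.symm
        have h2 := (Finset.sum_eq_zero_iff_of_nonneg (fun i _ => rowMass_nonneg a i)).mp h1 i
          (Finset.mem_univ _)
        have h3 := (Finset.sum_eq_zero_iff_of_nonneg (fun j _ => sq_nonneg (a i j))).mp h2 j
          (Finset.mem_univ _)
        exact pow_eq_zero_iff (n := 2) (by norm_num) |>.mp h3
      have : Z a σ₀ - mean a = 0 := by simp [Z, mean, hzero]
      rw [this, abs_zero] at ht0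
      linarith
  have hv0 : 0 < Q / n := div_pos hQpos hn0
  have hcardS : (S.card : ℝ) ≤ n.factorial := by
    have : S.card ≤ (univ : Finset (Perm (Fin n))).card := Finset.card_le_card (filter_subset _ _)
    rw [Finset.card_univ, Fintype.card_perm, Fintype.card_fin] at this
    exact_mod_cast this
  -- small n
  by_cases hn4 : n < 4
  · have hE' : E ≤ 2 * Real.log 2 := by
      have hden : 0 < m * t / 3 := by positivity
      have h1 : E ≤ t ^ 2 / (16 * (m * t / 3)) := by
        apply div_le_div_of_nonneg_left (sq_nonneg _) (by positivity)
        nlinarith [mul_pos hθ0 hv0]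
      have h2 : t ^ 2 / (16 * (m * t / 3)) = 3 * t / (16 * m) := by
        field_simp
      have h3 : 3 * t / (16 * m) ≤ 3 * (2 * n * m) / (16 * m) :=
        div_le_div_of_nonneg_right (by linarith) (by positivity)
      have h4 : 3 * (2 * (n : ℝ) * m) / (16 * m) = 3 * n / 8 := by
        field_simp; ring
      have h5 : (n : ℝ) ≤ 3 := by exact_mod_cast (by omega : n ≤ 3)
      have := Real.log_two_gt_d9
      linarith
    exact small_case (Nat.cast_nonneg _) hcardS hE'
  -- main case n ≥ 4
  have hn4' : 4 ≤ n := not_lt.mp hn4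
  haveI : NeZero n := ⟨by omega⟩
  obtain ⟨KA, hKA⟩ : ∃ K, K = n - n / 2 := ⟨_, rfl⟩
  obtain ⟨KB, hKB⟩ : ∃ K, K = n / 2 := ⟨_, rfl⟩
  have hKAB : KA + KB = n := by omega
  have hKAn : KA < n := by omega
  have hKA1 : 1 ≤ KA := by omega
  have hKB1 : 1 ≤ KB := by omega
  have hKA2 : 2 * KA ≤ n + 1 := by omega
  have hKB2 : 2 * KB ≤ n + 1 := by omega
  have hKBn : KB < n := by omega
  have hnKA : n ≤ 2 * KA := by omega
  have hnKB : 2 * KB ≤ n := by omega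
  obtain ⟨kA, hkA⟩ : ∃ k : Fin n, (k : ℕ) = KA := ⟨⟨KA, hKAn⟩, rfl⟩
  -- sorting
  obtain ⟨ρ, hsort⟩ : ∃ ρ : Perm (Fin n), ∀ i j : Fin n, i ≤ j → rowMass a (ρ j) ≤ rowMass a (ρ i) := by
    refine ⟨Tuple.sort (fun i => -rowMass a i), fun i j hij => ?_⟩
    have := Tuple.monotone_sort (fun i => -rowMass a i) hij
    simpa using this
  set eB : Fin n → Fin n := fun i => ρ (i + kA) with heB
  set cA := block a ρ KA with hcA
  set cB := block a eB KB with hcB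
  have hdecomp : ∀ σ : Perm (Fin n), Z a σ - mean a =
      (Z cA (ρ.trans σ) - mean cA) +
        (Z cB (((Equiv.addRight kA).trans ρ).trans σ) - mean cB) :=
    fun σ => decomp a hKAB kA hkA ρ σ
  -- masses of the blocks
  set QA := ∑ i, rowMass cA i with hQA
  set QB := ∑ i, rowMass cB i with hQB
  have hQA' : QA = ∑ i : Fin n, if (i : ℕ) < KA then rowMass a (ρ i) else 0 := by
    rw [hQA]; simp only [hcA, rowMass_block]
  have hQB' : QB = ∑ i : Fin n, if (i : ℕ) < KB then rowMass a (ρ (i + kA)) else 0 := by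
    rw [hQB]; simp only [hcB, rowMass_block, heB]
  have hQsplit : Q = QA + QB := by
    rw [hQ', hQA', hQB']
    exact sum_split hKAB kA hkA ρ (rowMass a)
  have hQA0 : 0 ≤ QA := Finset.sum_nonneg fun i _ => rowMass_nonneg _ _
  have hQB0 : 0 ≤ QB := Finset.sum_nonneg fun i _ => rowMass_nonneg _ _
  have hlight : (n : ℝ) * QB ≤ KB * Q := by
    rw [hQsplit, hQA', hQB']
    exact light_rows (fun i => rowMass a (ρ i)) hsort hKAB kA hkA hKA1
  -- budgets
  have hWA : W n KA (rowMass cA) ≤ 8 * (3 / 5 : ℝ) ^ 2 * θ * (Q / n) := by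
    have hW := W_block_le n KA (rowMass cA) (rowMass_nonneg cA)
      (by intro k hk; simp [hcA, rowMass_block, not_lt.mpr hk])
      (by
        intro i j hij hj
        have hi : (i : ℕ) < KA := lt_of_le_of_lt hij hj
        simp only [hcA, rowMass_block, if_pos hi, if_pos hj]
        exact hsort i j (Fin.le_def.mpr hij))
      hKA1 hKA2 hKAn
    rw [← hQA] at hW
    exact WA_le hn4' hKAB hnKA hKA2 hKA1 hKB1 hQA0 (by linarith) hW
  have hWB : W n KB (rowMass cB) ≤ 8 * (2 / 5 : ℝ) ^ 2 * θ * (Q / n) := by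
    have hW := W_block_le n KB (rowMass cB) (rowMass_nonneg cB)
      (by intro k hk; simp [hcB, rowMass_block, not_lt.mpr hk])
      (by
        intro i j hij hj
        have hi : (i : ℕ) < KB := lt_of_le_of_lt hij hj
        simp only [hcB, rowMass_block, if_pos hi, if_pos hj, heB]
        apply hsort
        rw [Fin.le_def]
        have h1 := (val_add_iff hKAB kA hkA i).2 hi
        have h2 := (val_add_iff hKAB kA hkA j).2 hj
        omega)
      hKB1 hKB2 hKBn
    rw [← hQB] at hW
    exact WB_le hn4' hKAB hnKA hnKB hKA1 hKB1 hQ0 hlight hW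
  -- tails of the blocks
  have hVA : 0 < 8 * (3 / 5 : ℝ) ^ 2 * θ * (Q / n) := by positivity
  have hVB : 0 < 8 * (2 / 5 : ℝ) ^ 2 * θ * (Q / n) := by positivity
  have htA := two_sided_block_tail a ρ KA ρ hm0.le hm hKA2 hVA hWA
    (show 3 * m ≤ 8 * (3 / 5 : ℝ) * m by nlinarith) (show 0 ≤ 3 / 5 * t by positivity)
  have htB := two_sided_block_tail a eB KB ((Equiv.addRight kA).trans ρ) hm0.le hm hKB2 hVB hWB
    (show 3 * m ≤ 8 * (2 / 5 : ℝ) * m by nlinarith) (show 0 ≤ 2 / 5 * t by positivity)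
  -- the exponents coincide with E
  have hden : 0 < θ * (Q / n) + m * t / 3 := by positivity
  have hexA : (3 / 5 * t) ^ 2 / (2 * (8 * (3 / 5 : ℝ) ^ 2 * θ * (Q / n) +
      8 * (3 / 5 : ℝ) * m * (3 / 5 * t) / 3)) = E := by
    rw [hE]
    have : 2 * (8 * (3 / 5 : ℝ) ^ 2 * θ * (Q / n) + 8 * (3 / 5 : ℝ) * m * (3 / 5 * t) / 3)
        = (3 / 5) ^ 2 * (16 * (θ * (Q / n) + m * t / 3)) := by ring
    rw [this, mul_pow, mul_div_mul_left _ _ (by norm_num)]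
  have hexB : (2 / 5 * t) ^ 2 / (2 * (8 * (2 / 5 : ℝ) ^ 2 * θ * (Q / n) +
      8 * (2 / 5 : ℝ) * m * (2 / 5 * t) / 3)) = E := by
    rw [hE]
    have : 2 * (8 * (2 / 5 : ℝ) ^ 2 * θ * (Q / n) + 8 * (2 / 5 : ℝ) * m * (2 / 5 * t) / 3)
        = (2 / 5) ^ 2 * (16 * (θ * (Q / n) + m * t / 3)) := by ring
    rw [this, mul_pow, mul_div_mul_left _ _ (by norm_num)]
  rw [hexA] at htA
  rw [hexB] at htB
  have := union_four (fun σ => Z a σ - mean a) (fun σ => Z cA (ρ.trans σ) - mean cA)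
    (fun σ => Z cB (((Equiv.addRight kA).trans ρ).trans σ) - mean cB) hdecomp t
    ((n.factorial : ℝ) * Real.exp (-E)) htA htB
  calc (S.card : ℝ) ≤ 4 * ((n.factorial : ℝ) * Real.exp (-E)) := this
    _ = 4 * (n.factorial : ℝ) * Real.exp (-E) := by ring


end BercuDelyonRio

/-- **Bernstein's inequality for randomly permuted sums** (Bercu–Delyon–Rio 2015; Albert 2019,
Thm. 1.5), discharge of the named fact `BercuDelyonRio2015_permutedSum`: for every real `n × n` array
with entries in `[-m, m]` and every `t > 0`,
`#{π ∈ Sₙ : t ≤ |Σᵢ a_{i,π(i)} - n⁻¹ Σᵢⱼ aᵢⱼ|} ≤ 4·n!·exp(-t²/(16(θ n⁻¹ Σᵢⱼ aᵢⱼ² + m t/3)))`,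
`θ = (5/2) ln 3 - 2/3`. Proof: `BercuDelyonRio.main_bound` (martingale/recursion argument described in
the module docstring). [cite: Albert2019, Thm. 1.5] -/
theorem BercuDelyonRio2015_permutedSum_holds : BercuDelyonRio2015_permutedSum := by
  intro n m a hm t ht
  have h := BercuDelyonRio.main_bound n m a hm t ht
  simpa only [BercuDelyonRio.Z, BercuDelyonRio.mean] using h

end Literature.Probability.Moments
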